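import Literature.NumberTheory.Automorphic.BLZPeriodCocycleHolomorphy

/-!
# Towards BLZ Proposition 5.1 — the transformation law of the canonical integral

Bruggeman, Lewis and Zagier, *Period functions for Maass wave forms and cohomology*,
Mem. AMS 237 no. 1118 (2015) [BruggemanLewisZagier2015], Proposition 5.1 (p. 30; proof p. 31):
"If the discrete subgroup `Γ ⊂ G` is infinite, then `r`, `p` and `q` are injective."
This file continues `BLZPeriodCocycleProofs.lean` (§1–§8) and `BLZPeriodCocycleHolomorphy.lean`
(§9–§16) with §17–§22 of the road map (the statement is the named fact
`BruggemanLewisZagier2015_prop_5_1` in `BLZPeriodCocycle.lean`).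

## What is here (all proved)

* §17 `differentiableAt_greenSegmentIntegral_param'`, `exists_ball_differentiableOn_param_real`:
  holomorphy of `η ↦ ∫_a^b [u, (R_η/R_η(z₀))^s]` in the kernel parameter over a fixed segment of
  `ℍ`, in particular near every real `η = t` (the holomorphic extension of the canonical cocycle
  `R_t(z₀)^{-s} r_γ(t)` to a complex neighbourhood of `ℝ`);
* §18 `exists_complex_extension` (a real-analytic `φ : ℝ → ℂ` is locally the restriction of a
  holomorphic function) and `eqOn_of_eqOn_real` (identity principle along the real axis);
* §19 `greenSegmentIntegral_comp_smul_of_level` (Möbius change of variables for forms closed on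
  a half-plane `{Im > h}` only) and `ratioBase_mem_slitPlane_of_im_le` (the cut of
  `w ↦ (R_η(w)/R_η(a))^s` lies below `Im η` when `Im η < Im a`);
* §20 `im_div_normSq_moebius_lt` (the `g`-image arc of a segment ending near the real axis stays
  above its endpoint);
* §21 `tendsto_truncatedCanonical` (radial truncation) and `continuousWithinAt_canonicalCone`
  (continuity of `q ↦ ∫_{z₀}^{q} [u, (R_η/R_η(a))^s]` as `q → η` inside `{Im q ≥ Im η}`);
* §22 **`canonicalIntegral_transform`**: for `g ∈ Γ` of determinant one, `η = g ζ`, `a₁ = g z₀`,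
  `μ = R_η(z₀)/R_η(a₁)` and `ζ` close to the real axis,
  `∫_{z₀}^{ζ} [u, (R_ζ/R_ζ(z₀))^s] = μ^s (∫_{a₁}^{z₀} [u, (R_η/R_η(z₀))^s] + ∫_{z₀}^{η} [u, (R_η/R_η(z₀))^s])`
  — the `Γ`-equivariance of the canonical hybrid model (companion paper, Bruggeman–Lewis–Zagier,
  *Function theory related to the group PSL₂(ℝ)*, §4.2) from which the twisted functional
  equation of `D = Φ - h` on a collar follows.

## References

* [BruggemanLewisZagier2015] R. Bruggeman, J. Lewis, D. Zagier, *Period functions for Maass wave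
  forms and cohomology*, Mem. Amer. Math. Soc. 237 (2015), no. 1118, doi:10.1090/memo/1118:
  (1.7) p. 10; (1.10) p. 11; (2.2) p. 12; (2.25) p. 16; Proposition 5.1 pp. 30–31.
* R. Bruggeman, J. Lewis, D. Zagier, *Function theory related to the group PSL₂(ℝ)*, in
  *From Fourier analysis and number theory to Radon transforms and geometry*, Dev. Math. 28,
  Springer (2013), 107–201, §4.2, Theorem 4.2.
-/

noncomputable section

namespace Literature.NumberTheory.Automorphic

open _root_.UpperHalfPlane _root_.Complex _root_.Filter _root_.Set _root_.MeasureTheory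
open scoped MatrixGroups Topology ComplexConjugate
open Laplacian

/-! ## 17. Holomorphy in the kernel parameter over a fixed segment

For a fixed segment `[a, b] ⊂ ℍ` the segment integral `η ↦ ∫_a^b [U, (R_η/R_η(z₀))^s]` is
holomorphic in the kernel parameter `η` at every `η₀` forming a "good pair" with each point of
`[a, b]`: `η₀ ≠ w, w̄, z₀, z̄₀` and `R_{η₀}(w)/R_{η₀}(z₀)` off the cut.  Here, unlike §13, the
parameter may be real or in the lower half-plane: every real `η₀ = t` is good for every
`w ∈ ℍ` (the base is the positive real `R_t(w)/R_t(z₀)`), which gives the holomorphic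
extension `c_γ(η) = ∫_{γ⁻¹ z₀}^{z₀} [u, (R_η/R_η(z₀))^s]` of the canonical cocycle to a complex
neighbourhood of `ℝ` (companion paper §4.2). -/

section ParameterHolomorphy

variable {s : ℂ}

/-- The general set of good pairs `(η, w)` (`w ∈ ℍ`; `η ≠ w, w̄, z₀, z̄₀`; ratio base off the cut)
is open. [folklore] -/
theorem isOpen_goodPairs' (z₀ : ℂ) :
    IsOpen {q : ℂ × ℂ | 0 < q.2.im ∧ q.1 ≠ q.2 ∧ q.1 ≠ conj q.2 ∧ q.1 ≠ z₀ ∧ q.1 ≠ conj z₀ ∧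
      poissonKernelC q.1 q.2 / poissonKernelC q.1 z₀ ∈ Complex.slitPlane} := by
  set S : Set (ℂ × ℂ) := {q : ℂ × ℂ | 0 < q.2.im ∧ q.1 ≠ q.2 ∧ q.1 ≠ conj q.2 ∧ q.1 ≠ z₀ ∧
    q.1 ≠ conj z₀} with hS
  have hSo : IsOpen S := by
    simp only [hS, Set.setOf_and]
    exact (isOpen_lt continuous_const (Complex.continuous_im.comp continuous_snd)).inter
      ((isOpen_ne_fun continuous_fst continuous_snd).inter
      ((isOpen_ne_fun continuous_fst (Complex.continuous_conj.comp continuous_snd)).inter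
      ((isOpen_ne_fun continuous_fst continuous_const).inter
      (isOpen_ne_fun continuous_fst continuous_const))))
  have hne1 : ∀ q ∈ S, (q.1 - q.2) * (q.1 - conj q.2) ≠ 0 := fun q hq =>
    mul_ne_zero (sub_ne_zero.mpr hq.2.1) (sub_ne_zero.mpr hq.2.2.1)
  have hne2 : ∀ q ∈ S, (q.1 - z₀) * (q.1 - conj z₀) ≠ 0 := fun q hq =>
    mul_ne_zero (sub_ne_zero.mpr hq.2.2.2.1) (sub_ne_zero.mpr hq.2.2.2.2)
  by_cases hz₀ : z₀.im = 0
  · -- degenerate base point: `R_η(z₀) = 0`, the ratio is `0 ∉ slitPlane`... unless handled by `0/0`;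
    -- in all cases the set is still `S ∩ preimage`, with the ratio continuous where defined.
    have hzero : ∀ q : ℂ × ℂ, poissonKernelC q.1 z₀ = 0 := fun q => by
      simp [poissonKernelC, hz₀]
    have hempty : {q : ℂ × ℂ | 0 < q.2.im ∧ q.1 ≠ q.2 ∧ q.1 ≠ conj q.2 ∧ q.1 ≠ z₀ ∧ q.1 ≠ conj z₀ ∧
        poissonKernelC q.1 q.2 / poissonKernelC q.1 z₀ ∈ Complex.slitPlane} = ∅ := by
      ext q
      simp only [Set.mem_setOf_eq, Set.mem_empty_iff_false, iff_false, not_and]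
      intro _ _ _ _ _ h
      rw [hzero q, div_zero] at h
      exact Complex.zero_notMem_slitPlane h
    rw [hempty]; exact isOpen_empty
  have hne3 : ∀ q ∈ S, poissonKernelC q.1 z₀ ≠ 0 := by
    intro q hq
    unfold poissonKernelC
    exact div_ne_zero (by exact_mod_cast hz₀) (hne2 q hq)
  have hcont : ContinuousOn (fun q : ℂ × ℂ => poissonKernelC q.1 q.2 / poissonKernelC q.1 z₀) S := by
    refine ContinuousOn.div ?_ ?_ hne3
    · simp only [poissonKernelC]
      exact ContinuousOn.div (by fun_prop) (by fun_prop) hne1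
    · simp only [poissonKernelC]
      exact ContinuousOn.div (by fun_prop) (by fun_prop) hne2
  have h := hcont.isOpen_inter_preimage hSo Complex.isOpen_slitPlane
  have heq : {q : ℂ × ℂ | 0 < q.2.im ∧ q.1 ≠ q.2 ∧ q.1 ≠ conj q.2 ∧ q.1 ≠ z₀ ∧ q.1 ≠ conj z₀ ∧
      poissonKernelC q.1 q.2 / poissonKernelC q.1 z₀ ∈ Complex.slitPlane} =
      S ∩ (fun q : ℂ × ℂ => poissonKernelC q.1 q.2 / poissonKernelC q.1 z₀) ⁻¹' Complex.slitPlane := by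
    ext q
    simp only [hS, Set.mem_setOf_eq, Set.mem_inter_iff, Set.mem_preimage]
    tauto
  rw [heq]
  exact h

/-- At a general good pair the hypotheses of the kernel lemmas hold. [folklore] -/
theorem goodPair'_props {z₀ η w : ℂ} (hz₀ : 0 < z₀.im)
    (h : (η, w) ∈ {q : ℂ × ℂ | 0 < q.2.im ∧ q.1 ≠ q.2 ∧ q.1 ≠ conj q.2 ∧ q.1 ≠ z₀ ∧ q.1 ≠ conj z₀ ∧
      poissonKernelC q.1 q.2 / poissonKernelC q.1 z₀ ∈ Complex.slitPlane}) :
    0 < w.im ∧ η ≠ w ∧ conj η ≠ w ∧ η ≠ conj w ∧ poissonKernelC η z₀ ≠ 0 ∧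
      poissonKernelC η w / poissonKernelC η z₀ ∈ Complex.slitPlane := by
  obtain ⟨hw, hηw, hηw', hηz₀, hηz₀', hslit⟩ := h
  refine ⟨hw, hηw, ?_, hηw', poissonKernelC_ne_zero hz₀ hηz₀ hηz₀', hslit⟩
  intro hh; apply hηw'; rw [← hh, Complex.conj_conj]

/-- Holomorphy of `η ↦ (R_η(w)/R_η(z₀))^s` at a general good pair. [cite: BruggemanLewisZagier2015, (1.7) p. 10] -/
theorem differentiableAt_ratioKernel_param' (s : ℂ) {z₀ η w : ℂ} (hz₀ : 0 < z₀.im)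
    (h : (η, w) ∈ {q : ℂ × ℂ | 0 < q.2.im ∧ q.1 ≠ q.2 ∧ q.1 ≠ conj q.2 ∧ q.1 ≠ z₀ ∧ q.1 ≠ conj z₀ ∧
      poissonKernelC q.1 q.2 / poissonKernelC q.1 z₀ ∈ Complex.slitPlane}) :
    DifferentiableAt ℂ (fun ζ : ℂ => ratioKernel s z₀ ζ w) η := by
  obtain ⟨hw, hηw, _, hηw', hpz, hslit⟩ := goodPair'_props hz₀ h
  have hηz₀ : η ≠ z₀ := h.2.2.2.1
  have hηz₀' : η ≠ conj z₀ := h.2.2.2.2.1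
  unfold ratioKernel
  exact ((differentiableAt_poissonKernelC_param hηw hηw').div
    (differentiableAt_poissonKernelC_param hηz₀ hηz₀') hpz).cpow_const hslit

/-- Joint continuity of `(η, w) ↦ (R_η(w)/R_η(z₀))^s` at general good pairs. [folklore] -/
theorem continuousOn_ratioKernel_pair' (s : ℂ) {z₀ : ℂ} (hz₀ : 0 < z₀.im) :
    ContinuousOn (fun q : ℂ × ℂ => ratioKernel s z₀ q.1 q.2)
      {q : ℂ × ℂ | 0 < q.2.im ∧ q.1 ≠ q.2 ∧ q.1 ≠ conj q.2 ∧ q.1 ≠ z₀ ∧ q.1 ≠ conj z₀ ∧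
        poissonKernelC q.1 q.2 / poissonKernelC q.1 z₀ ∈ Complex.slitPlane} := by
  intro q hq
  obtain ⟨hw, hηw, _, hηw', hpz, hslit⟩ := goodPair'_props hz₀ hq
  have hηz₀ : q.1 ≠ z₀ := hq.2.2.2.1
  have hηz₀' : q.1 ≠ conj z₀ := hq.2.2.2.2.1
  unfold ratioKernel
  refine ContinuousWithinAt.cpow ?_ continuousWithinAt_const hslit
  apply ContinuousAt.continuousWithinAt
  simp only [poissonKernelC]
  refine ContinuousAt.div ?_ ?_ hpz
  · refine ContinuousAt.div (by fun_prop) (by fun_prop) ?_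
    exact mul_ne_zero (sub_ne_zero.mpr hηw) (sub_ne_zero.mpr hηw')
  · refine ContinuousAt.div (by fun_prop) (by fun_prop) ?_
    exact mul_ne_zero (sub_ne_zero.mpr hηz₀) (sub_ne_zero.mpr hηz₀')

/-- **Uniform good neighbourhood of a good segment**: if `η₀` is good for every point of the
compact segment `[a, b]`, then so is every `η` near `η₀` for every `w` near `[a, b]`. [folklore] -/
theorem exists_uniform_good_nhd' {z₀ η₀ a b : ℂ}
    (hgood : ∀ w ∈ segment ℝ a b, (η₀, w) ∈ {q : ℂ × ℂ | 0 < q.2.im ∧ q.1 ≠ q.2 ∧ q.1 ≠ conj q.2 ∧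
      q.1 ≠ z₀ ∧ q.1 ≠ conj z₀ ∧ poissonKernelC q.1 q.2 / poissonKernelC q.1 z₀ ∈ Complex.slitPlane}) :
    ∃ δ > 0, ∀ η ∈ Metric.ball η₀ δ, ∀ w ∈ Metric.thickening δ (segment ℝ a b),
      (η, w) ∈ {q : ℂ × ℂ | 0 < q.2.im ∧ q.1 ≠ q.2 ∧ q.1 ≠ conj q.2 ∧ q.1 ≠ z₀ ∧ q.1 ≠ conj z₀ ∧
        poissonKernelC q.1 q.2 / poissonKernelC q.1 z₀ ∈ Complex.slitPlane} := by
  set K : Set (ℂ × ℂ) := ({η₀} : Set ℂ) ×ˢ segment ℝ a b with hK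
  have hKc : IsCompact K := isCompact_singleton.prod (by
    rw [segment_eq_image_lineMap]
    exact isCompact_Icc.image (AffineMap.lineMap_continuous))
  have hKO : K ⊆ {q : ℂ × ℂ | 0 < q.2.im ∧ q.1 ≠ q.2 ∧ q.1 ≠ conj q.2 ∧ q.1 ≠ z₀ ∧ q.1 ≠ conj z₀ ∧
      poissonKernelC q.1 q.2 / poissonKernelC q.1 z₀ ∈ Complex.slitPlane} := by
    rintro ⟨η, w⟩ ⟨hη, hw⟩
    have hη' : η = η₀ := hη
    subst hη'
    exact hgood w hw
  obtain ⟨δ, hδ, hδO⟩ := hKc.exists_thickening_subset_open (isOpen_goodPairs' z₀) hKO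
  refine ⟨δ, hδ, fun η hη w hw => hδO ?_⟩
  rw [Metric.mem_thickening_iff] at hw ⊢
  obtain ⟨w', hw', hww'⟩ := hw
  refine ⟨(η₀, w'), ⟨rfl, hw'⟩, ?_⟩
  rw [Prod.dist_eq]
  exact max_lt (Metric.mem_ball.mp hη) hww'

attribute [local irreducible] ratioKernel poissonKernelC in
/-- **Holomorphy in the kernel parameter of the segment integral over a fixed good segment.**
If `η₀` is good for every point of `[a, b] ⊂ ℍ`, then
`η ↦ ∫_a^b [U, (R_η/R_η(z₀))^s]` is complex differentiable at `η₀` (dominated differentiation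
under the integral, `Literature.Analysis.Complex.differentiableOn_intervalIntegral_of_continuousOn`).
[cite: BruggemanLewisZagier2015, (1.7) p. 10] -/
theorem differentiableAt_greenSegmentIntegral_param' (s : ℂ) {U : ℂ → ℂ}
    (hU : ContDiffOn ℝ 2 U {z : ℂ | 0 < z.im}) {z₀ η₀ a b : ℂ} (hz₀ : 0 < z₀.im)
    (hgood : ∀ w ∈ segment ℝ a b, (η₀, w) ∈ {q : ℂ × ℂ | 0 < q.2.im ∧ q.1 ≠ q.2 ∧ q.1 ≠ conj q.2 ∧
      q.1 ≠ z₀ ∧ q.1 ≠ conj z₀ ∧ poissonKernelC q.1 q.2 / poissonKernelC q.1 z₀ ∈ Complex.slitPlane}) :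
    DifferentiableAt ℂ (fun η : ℂ => greenSegmentIntegral U (ratioKernel s z₀ η) a b) η₀ := by
  obtain ⟨δ, hδ, hgood1⟩ := exists_uniform_good_nhd' hgood
  set hv : ℂ := b - a with hhv
  have hseg : ∀ σ ∈ Icc (0 : ℝ) 1, (1 - (σ : ℂ)) * a + (σ : ℂ) * b ∈ segment ℝ a b := by
    intro σ hσ
    rw [segment_eq_image_lineMap]
    refine ⟨σ, hσ, ?_⟩
    rw [AffineMap.lineMap_apply_module]; simp only [Complex.real_smul]; push_cast; ring
  have hgood' : ∀ η ∈ Metric.ball η₀ δ, ∀ σ ∈ Icc (0 : ℝ) 1,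
      (η, (1 - (σ : ℂ)) * a + (σ : ℂ) * b) ∈ {q : ℂ × ℂ | 0 < q.2.im ∧ q.1 ≠ q.2 ∧ q.1 ≠ conj q.2 ∧
        q.1 ≠ z₀ ∧ q.1 ≠ conj z₀ ∧ poissonKernelC q.1 q.2 / poissonKernelC q.1 z₀ ∈ Complex.slitPlane} :=
    fun η hη σ hσ => hgood1 η hη _ (Metric.self_subset_thickening hδ _ (hseg σ hσ))
  set g : ℂ → ℝ → ℂ := fun η σ =>
    wirtingerDz U ((1 - (σ : ℂ)) * a + (σ : ℂ) * b) *
        ratioKernel s z₀ η ((1 - (σ : ℂ)) * a + (σ : ℂ) * b) * hv +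
      U ((1 - (σ : ℂ)) * a + (σ : ℂ) * b) *
        (ratioKernel s z₀ η ((1 - (σ : ℂ)) * a + (σ : ℂ) * b) *
          (s * Complex.I * (η - ((1 - (σ : ℂ)) * a + (σ : ℂ) * b)) /
            (2 * ((((1 - (σ : ℂ)) * a + (σ : ℂ) * b).im : ℝ) : ℂ) *
              (η - conj ((1 - (σ : ℂ)) * a + (σ : ℂ) * b))))) * conj hv with hg
  have heq : ∀ η ∈ Metric.ball η₀ δ,
      greenSegmentIntegral U (ratioKernel s z₀ η) a b = ∫ σ in (0:ℝ)..1, g η σ := by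
    intro η hη
    unfold greenSegmentIntegral
    refine intervalIntegral.integral_congr fun σ hσ => ?_
    rw [uIcc_of_le zero_le_one] at hσ
    obtain ⟨hw, hηw, _, hηw', hpz, hslit⟩ := goodPair'_props hz₀ (hgood' η hη σ hσ)
    simp only [hg, greenForm, ← hhv]
    rw [wirtingerDzbar_ratioKernel s hw hηw hηw' hpz hslit]
  have hO : IsOpen {z : ℂ | 0 < z.im} := isOpen_upperHalfPlaneSet
  have hdiff : ∀ σ ∈ Icc (0 : ℝ) 1, DifferentiableOn ℂ (fun η => g η σ) (Metric.ball η₀ δ) := by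
    intro σ hσ η hη
    apply DifferentiableAt.differentiableWithinAt
    obtain ⟨hw, hηw, _, hηw', hpz, hslit⟩ := goodPair'_props hz₀ (hgood' η hη σ hσ)
    have hV := differentiableAt_ratioKernel_param' s hz₀ (hgood' η hη σ hσ)
    have hden : 2 * ((((1 - (σ : ℂ)) * a + (σ : ℂ) * b).im : ℝ) : ℂ) *
        (η - conj ((1 - (σ : ℂ)) * a + (σ : ℂ) * b)) ≠ 0 :=
      mul_ne_zero (mul_ne_zero two_ne_zero (by exact_mod_cast hw.ne')) (sub_ne_zero.mpr hηw')
    simp only [hg]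
    refine (((differentiableAt_const _).mul hV).mul (differentiableAt_const _)).add ?_
    refine ((differentiableAt_const _).mul (hV.mul ?_)).mul (differentiableAt_const _)
    exact DifferentiableAt.div (by fun_prop) (by fun_prop) hden
  have hcont : ContinuousOn (Function.uncurry g) (Metric.ball η₀ δ ×ˢ Icc (0 : ℝ) 1) := by
    have hmaps : MapsTo (fun q : ℂ × ℝ => (q.1, (1 - (q.2 : ℂ)) * a + (q.2 : ℂ) * b))
        (Metric.ball η₀ δ ×ˢ Icc (0 : ℝ) 1)
        {q : ℂ × ℂ | 0 < q.2.im ∧ q.1 ≠ q.2 ∧ q.1 ≠ conj q.2 ∧ q.1 ≠ z₀ ∧ q.1 ≠ conj z₀ ∧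
          poissonKernelC q.1 q.2 / poissonKernelC q.1 z₀ ∈ Complex.slitPlane} :=
      fun q hq => hgood' q.1 hq.1 q.2 hq.2
    have hpt : Continuous (fun q : ℂ × ℝ => (1 - (q.2 : ℂ)) * a + (q.2 : ℂ) * b) := by fun_prop
    have hV : ContinuousOn (fun q : ℂ × ℝ => ratioKernel s z₀ q.1 ((1 - (q.2 : ℂ)) * a + (q.2 : ℂ) * b))
        (Metric.ball η₀ δ ×ˢ Icc (0 : ℝ) 1) :=
      ContinuousOn.comp (g := fun q : ℂ × ℂ => ratioKernel s z₀ q.1 q.2)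
        (f := fun q : ℂ × ℝ => (q.1, (1 - (q.2 : ℂ)) * a + (q.2 : ℂ) * b))
        (continuousOn_ratioKernel_pair' s hz₀) (by fun_prop) hmaps
    have hmapsH : MapsTo (fun q : ℂ × ℝ => (1 - (q.2 : ℂ)) * a + (q.2 : ℂ) * b)
        (Metric.ball η₀ δ ×ˢ Icc (0 : ℝ) 1) {z : ℂ | 0 < z.im} :=
      fun q hq => (hgood' q.1 hq.1 q.2 hq.2).1
    have hUc : ContinuousOn (fun q : ℂ × ℝ => U ((1 - (q.2 : ℂ)) * a + (q.2 : ℂ) * b))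
        (Metric.ball η₀ δ ×ˢ Icc (0 : ℝ) 1) := hU.continuousOn.comp hpt.continuousOn hmapsH
    have hDzc : ContinuousOn (fun q : ℂ × ℝ => wirtingerDz U ((1 - (q.2 : ℂ)) * a + (q.2 : ℂ) * b))
        (Metric.ball η₀ δ ×ˢ Icc (0 : ℝ) 1) :=
      (continuousOn_wirtingerDz hO hU).comp hpt.continuousOn hmapsH
    have hfrac : ContinuousOn (fun q : ℂ × ℝ =>
        s * Complex.I * (q.1 - ((1 - (q.2 : ℂ)) * a + (q.2 : ℂ) * b)) /
          (2 * ((((1 - (q.2 : ℂ)) * a + (q.2 : ℂ) * b).im : ℝ) : ℂ) *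
            (q.1 - conj ((1 - (q.2 : ℂ)) * a + (q.2 : ℂ) * b))))
        (Metric.ball η₀ δ ×ˢ Icc (0 : ℝ) 1) := by
      refine ContinuousOn.div (by fun_prop) ?_ ?_
      · exact ((continuous_const.mul (Complex.continuous_ofReal.comp (Complex.continuous_im.comp hpt))).mul
          (continuous_fst.sub (Complex.continuous_conj.comp hpt))).continuousOn
      · intro q hq
        obtain ⟨hw, _, _, hηw', _, _⟩ := goodPair'_props hz₀ (hgood' q.1 hq.1 q.2 hq.2)
        exact mul_ne_zero (mul_ne_zero two_ne_zero (by exact_mod_cast hw.ne')) (sub_ne_zero.mpr hηw')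
    have : Function.uncurry g = fun q : ℂ × ℝ =>
        wirtingerDz U ((1 - (q.2 : ℂ)) * a + (q.2 : ℂ) * b) *
            ratioKernel s z₀ q.1 ((1 - (q.2 : ℂ)) * a + (q.2 : ℂ) * b) * hv +
          U ((1 - (q.2 : ℂ)) * a + (q.2 : ℂ) * b) *
            (ratioKernel s z₀ q.1 ((1 - (q.2 : ℂ)) * a + (q.2 : ℂ) * b) *
              (s * Complex.I * (q.1 - ((1 - (q.2 : ℂ)) * a + (q.2 : ℂ) * b)) /
                (2 * ((((1 - (q.2 : ℂ)) * a + (q.2 : ℂ) * b).im : ℝ) : ℂ) *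
                  (q.1 - conj ((1 - (q.2 : ℂ)) * a + (q.2 : ℂ) * b))))) * conj hv := by
      funext q; simp only [Function.uncurry, hg]
    rw [this]
    exact ((hDzc.mul hV).mul continuousOn_const).add ((hUc.mul (hV.mul hfrac)).mul continuousOn_const)
  have hD := Literature.Analysis.Complex.differentiableOn_intervalIntegral_of_continuousOn
    Metric.isOpen_ball zero_le_one hdiff hcont
  have hball : Metric.ball η₀ δ ∈ 𝓝 η₀ := Metric.ball_mem_nhds η₀ hδ
  refine (hD.differentiableAt hball).congr_of_eventuallyEq ?_
  filter_upwards [hball] with η hη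
  exact heq η hη

/-- **Real parameters are good**: for real `t`, `w ∈ ℍ` and `z₀ ∈ ℍ`, the pair `(t, w)` is good
(the ratio base `R_t(w)/R_t(z₀)` is a positive real). [cite: BruggemanLewisZagier2015, (1.6) p. 10] -/
theorem goodPair'_ofReal {z₀ w : ℂ} (hz₀ : 0 < z₀.im) (hw : 0 < w.im) (t : ℝ) :
    ((t : ℂ), w) ∈ {q : ℂ × ℂ | 0 < q.2.im ∧ q.1 ≠ q.2 ∧ q.1 ≠ conj q.2 ∧ q.1 ≠ z₀ ∧ q.1 ≠ conj z₀ ∧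
      poissonKernelC q.1 q.2 / poissonKernelC q.1 z₀ ∈ Complex.slitPlane} := by
  refine ⟨hw, ?_, ?_, ?_, ?_, ?_⟩
  · intro h; have := congrArg Complex.im h; simp at this; linarith
  · intro h; have := congrArg Complex.im h; simp at this; linarith
  · intro h; have := congrArg Complex.im h; simp at this; linarith
  · intro h; have := congrArg Complex.im h; simp at this; linarith
  · show poissonKernelC t w / poissonKernelC t z₀ ∈ Complex.slitPlane
    rw [poissonKernelC_ofReal, poissonKernelC_ofReal, ← Complex.ofReal_div]
    exact Complex.ofReal_mem_slitPlane.2 (div_pos (hypPoissonKernel_pos t hw) (hypPoissonKernel_pos t hz₀))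

/-- **The canonical cocycle extends holomorphically to a neighbourhood of `ℝ`**: for a segment
`[a, b] ⊂ ℍ` and real `t` there is `δ > 0` such that `η ↦ ∫_a^b [U, (R_η/R_η(z₀))^s]` is
holomorphic on the disc `|η - t| < δ` (companion paper §4.2: the hybrid-model cocycle
`R_t(z₀)^{-s} r_γ(t)` is the restriction of a holomorphic function near `P¹(ℝ)`).
[cite: BruggemanLewisZagier2015, Proposition 5.1 pp. 30–31] -/
theorem exists_ball_differentiableOn_param_real (s : ℂ) {U : ℂ → ℂ}
    (hU : ContDiffOn ℝ 2 U {z : ℂ | 0 < z.im}) {z₀ a b : ℂ} (hz₀ : 0 < z₀.im) (ha : 0 < a.im)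
    (hb : 0 < b.im) (t : ℝ) :
    ∃ δ > 0, DifferentiableOn ℂ (fun η : ℂ => greenSegmentIntegral U (ratioKernel s z₀ η) a b)
      (Metric.ball (t : ℂ) δ) := by
  have hseg : ∀ w ∈ segment ℝ a b, 0 < w.im := by
    intro w hw
    have hconv : Convex ℝ {z : ℂ | 0 < z.im} := convex_halfSpace_im_gt 0
    exact hconv.segment_subset ha hb hw
  have hgood : ∀ w ∈ segment ℝ a b, ((t : ℂ), w) ∈ {q : ℂ × ℂ | 0 < q.2.im ∧ q.1 ≠ q.2 ∧
      q.1 ≠ conj q.2 ∧ q.1 ≠ z₀ ∧ q.1 ≠ conj z₀ ∧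
      poissonKernelC q.1 q.2 / poissonKernelC q.1 z₀ ∈ Complex.slitPlane} :=
    fun w hw => goodPair'_ofReal hz₀ (hseg w hw) t
  obtain ⟨δ, hδ, hgood1⟩ := exists_uniform_good_nhd' hgood
  refine ⟨δ, hδ, fun η hη => ?_⟩
  apply DifferentiableAt.differentiableWithinAt
  apply differentiableAt_greenSegmentIntegral_param' s hU hz₀
  intro w hw
  exact hgood1 η hη w (Metric.self_subset_thickening hδ _ hw)

end ParameterHolomorphy

/-! ## 18. Complexification of real-analytic functions

A real-analytic `φ : ℝ → ℂ` near `t₀` is the restriction of a holomorphic function on a complex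
disc around `t₀`: if `φ(t₀ + y) = Σ aₙ yⁿ` then `Φ(η) = Σ aₙ (η - t₀)ⁿ` (the series
`FormalMultilinearSeries.ofScalars ℂ a` has the same radius).  This provides the holomorphic
functions near `P¹(ℝ)` of which analytic vectors are the boundary restrictions ((2.2), the
realization of `V_s^ω` in holomorphic functions on a neighbourhood of `P¹(ℝ)`, p. 12). -/

section Complexification

open scoped ENNReal NNReal

open FormalMultilinearSeries in
/-- The complexified series at a real point sums to the real series. [folklore] -/
theorem ofScalars_coeff_sum_ofReal (p : FormalMultilinearSeries ℝ ℝ ℂ) (y : ℝ) :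
    (ofScalars ℂ (fun n => p.coeff n)).sum (y : ℂ) = p.sum y := by
  unfold FormalMultilinearSeries.sum
  congr 1
  funext n
  simp only [apply_eq_pow_smul_coeff, coeff_ofScalars, smul_eq_mul, Complex.real_smul,
    Complex.ofReal_pow]

open FormalMultilinearSeries in
/-- **Complexification.** A function `φ : ℝ → ℂ` real-analytic at `t₀` agrees near `t₀` with a
function holomorphic on a complex disc around `t₀`.
[cite: BruggemanLewisZagier2015, (2.2) p. 12] -/
theorem exists_complex_extension {φ : ℝ → ℂ} {t₀ : ℝ} (h : AnalyticAt ℝ φ t₀) :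
    ∃ r : ℝ, 0 < r ∧ ∃ Φ : ℂ → ℂ, DifferentiableOn ℂ Φ (Metric.ball (t₀ : ℂ) r) ∧
      ∀ t : ℝ, |t - t₀| < r → Φ t = φ t := by
  obtain ⟨p, r, hp⟩ := h
  obtain ⟨r', hr'0, hr'r⟩ := ENNReal.lt_iff_exists_nnreal_btwn.mp hp.r_pos
  have hr'pos : (0 : ℝ≥0∞) < r' := hr'0
  have hp' : HasFPowerSeriesOnBall φ p t₀ r' := hp.mono hr'pos hr'r.le
  set q : FormalMultilinearSeries ℂ ℂ ℂ := ofScalars ℂ (fun n => p.coeff n) with hq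
  have hlt : (r' : ℝ≥0∞) < p.radius := lt_of_lt_of_le hr'r hp.r_le
  obtain ⟨C, -, hC⟩ := p.norm_mul_pow_le_of_lt_radius hlt
  have hqr : (r' : ℝ≥0∞) ≤ q.radius := by
    refine q.le_radius_of_bound C fun n => ?_
    have : ‖q n‖ = ‖p n‖ := by
      rw [hq, ofScalars_norm, norm_apply_eq_norm_coef]
    rw [this]
    exact hC n
  have hqpos : 0 < q.radius := lt_of_lt_of_le hr'pos hqr
  have hqs : HasFPowerSeriesOnBall q.sum q 0 r' := (q.hasFPowerSeriesOnBall hqpos).mono hr'pos hqr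
  have hr'real : (0 : ℝ) < r' := by exact_mod_cast ENNReal.coe_pos.mp hr'pos
  refine ⟨r', hr'real, fun η => q.sum (η - t₀), ?_, ?_⟩
  · have hd := hqs.differentiableOn
    rw [Metric.eball_coe] at hd
    have hmaps : MapsTo (fun η : ℂ => η - t₀) (Metric.ball (t₀ : ℂ) r') (Metric.ball (0 : ℂ) r') := by
      intro η hη
      rw [Metric.mem_ball, dist_zero_right, ← dist_eq_norm]
      exact hη
    exact hd.comp ((differentiable_id.sub_const _).differentiableOn) hmaps
  · intro t ht
    show q.sum ((t : ℂ) - t₀) = φ t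
    have hy : ((t - t₀ : ℝ) : ℂ) = (t : ℂ) - t₀ := by push_cast; ring
    rw [← hy, hq, ofScalars_coeff_sum_ofReal]
    have hmem : (t - t₀ : ℝ) ∈ Metric.eball (0 : ℝ) r' := by
      rw [Metric.eball_coe, Metric.mem_ball, dist_zero_right, Real.norm_eq_abs]
      exact ht
    rw [← hp'.sum hmem]
    congr 1
    ring

/-- **Identity principle along the real axis.** Two functions holomorphic on a preconnected
open set `O ⊆ ℂ` containing the real point `t₀`, which agree at the real points of a punctured
real neighbourhood of `t₀`, agree on `O`. [folklore] -/
theorem eqOn_of_eqOn_real {f g : ℂ → ℂ} {O : Set ℂ} (hO : IsOpen O) (hOc : IsPreconnected O)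
    {t₀ : ℝ} (ht₀ : (t₀ : ℂ) ∈ O) (hf : DifferentiableOn ℂ f O) (hg : DifferentiableOn ℂ g O)
    (h : ∀ᶠ t : ℝ in 𝓝[≠] t₀, f t = g t) : EqOn f g O := by
  have hfa : AnalyticOnNhd ℂ f O := hf.analyticOnNhd hO
  have hga : AnalyticOnNhd ℂ g O := hg.analyticOnNhd hO
  refine hfa.eqOn_of_preconnected_of_frequently_eq hga hOc ht₀ ?_
  -- the real punctured neighbourhood maps into the complex punctured neighbourhood
  have htend : Tendsto (fun t : ℝ => (t : ℂ)) (𝓝[≠] t₀) (𝓝[≠] (t₀ : ℂ)) := by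
    refine tendsto_nhdsWithin_of_tendsto_nhds_of_eventually_within _
      (Complex.continuous_ofReal.continuousAt.mono_left nhdsWithin_le_nhds) ?_
    filter_upwards [self_mem_nhdsWithin] with t ht
    simpa using ht
  have hfreq : ∃ᶠ t : ℝ in 𝓝[≠] t₀, f t = g t := h.frequently
  exact htend.frequently hfreq

end Complexification

/-! ## 19. Local Möbius change of variables and the cut of the ratio kernel -/

section LocalMoebius

variable {U V : ℂ → ℂ} {g : GL (Fin 2) ℝ}

/-- **Möbius change of variables in `∫ [U, V]`, local version**: as
`greenSegmentIntegral_comp_smul`, but with `U`, `V` of class `C²` and `U ΔV = V ΔU` only on a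
half-plane `{Im > h}` (`h ≥ 0`) containing the image arc `M_g([a, b])` (hence the segment
`[g a, g b]` and the affine homotopy between them). This is the form needed for the ratio kernel
`(R_η/R_η(z₀))^s`, which is singular at `η ∈ ℍ` and across its cut.
[cite: BruggemanLewisZagier2015, (1.10a) p. 11] -/
theorem greenSegmentIntegral_comp_smul_of_level (hg : 0 < g.det.val) {h : ℝ} (hh : 0 ≤ h)
    (hU : ContDiffOn ℝ 2 U {z : ℂ | h < z.im}) (hV : ContDiffOn ℝ 2 V {z : ℂ | h < z.im})
    (hΔ : ∀ w : ℂ, h < w.im → U w * (Δ V) w = V w * (Δ U) w) (a b : ℍ)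
    (harc : ∀ τ ∈ Icc (0 : ℝ) 1,
      h < (((g • ofComplex (AffineMap.lineMap (a : ℂ) (b : ℂ) τ) : ℍ) : ℂ)).im) :
    greenSegmentIntegral (U ∘ fun w : ℂ => ((g • ofComplex w : ℍ) : ℂ))
        (V ∘ fun w : ℂ => ((g • ofComplex w : ℍ) : ℂ)) a b =
      greenSegmentIntegral U V ((g • a : ℍ) : ℂ) ((g • b : ℍ) : ℂ) := by
  set O : Set ℂ := {z : ℂ | h < z.im} with hO
  have hOo : IsOpen O := isOpen_lt continuous_const Complex.continuous_im
  have hOH : ∀ z ∈ O, 0 < z.im := fun z hz => lt_of_le_of_lt hh hz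
  set M : ℂ → ℂ := fun w : ℂ => ((g • ofComplex w : ℍ) : ℂ) with hM
  have hg' : 0 < g.val.det := hg
  -- the segment and its image
  set ℓ : ℝ → ℂ := fun τ => AffineMap.lineMap (a : ℂ) (b : ℂ) τ with hℓ
  have hℓO : ∀ τ ∈ Icc (0 : ℝ) 1, 0 < (ℓ τ).im := fun τ hτ => by
    simp only [hℓ, AffineMap.lineMap_apply_module]
    simp only [Complex.add_im, Complex.real_smul, Complex.mul_im, Complex.ofReal_re,
      Complex.ofReal_im, zero_mul, add_zero]
    have ha : 0 < (a : ℂ).im := a.coe_im_pos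
    have hb : 0 < (b : ℂ).im := b.coe_im_pos
    rcases eq_or_lt_of_le hτ.1 with h0 | h0
    · rw [← h0]; simpa using ha
    · have : 0 ≤ 1 - τ := by linarith [hτ.2]
      nlinarith [mul_nonneg this ha.le, mul_pos h0 hb]
  have hMO : ∀ z : ℂ, 0 < z.im → 0 < (M z).im := fun z hz => by
    simp only [hM]; exact (g • ofComplex z).im_pos
  have harc' : ∀ τ ∈ Icc (0 : ℝ) 1, M (ℓ τ) ∈ O := fun τ hτ => harc τ hτ
  have hMder : ∀ z : ℂ, 0 < z.im → HasDerivAt M (deriv M z) z := fun z hz =>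
    ((UpperHalfPlane.hasStrictDerivAt_smul hg' ⟨z, hz⟩).hasDerivAt).differentiableAt.hasDerivAt
  -- Step 1: pointwise pullback of the integrand
  have hstep1 : greenSegmentIntegral (U ∘ M) (V ∘ M) a b =
      ∫ τ in (0 : ℝ)..1, greenForm U V (M (ℓ τ)) (deriv M (ℓ τ) * ((b : ℂ) - a)) := by
    unfold greenSegmentIntegral
    refine intervalIntegral.integral_congr fun τ hτ => ?_
    rw [uIcc_of_le zero_le_one] at hτ
    have hℓτ : (1 - (τ : ℂ)) * (a : ℂ) + (τ : ℂ) * (b : ℂ) = ℓ τ := by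
      simp only [hℓ, AffineMap.lineMap_apply_module, Complex.real_smul]; push_cast; ring
    simp only [hℓτ]
    have hz := hℓO τ hτ
    exact greenForm_comp ((hU.contDiffAt (hOo.mem_nhds (harc' τ hτ))).differentiableAt two_ne_zero)
      ((hV.contDiffAt (hOo.mem_nhds (harc' τ hτ))).differentiableAt two_ne_zero) (hMder _ hz) _
  -- the image path
  have hMc : ContinuousOn M {z : ℂ | 0 < z.im} := continuousOn_smulExtend hg
  let γ₁ : Path (M a) (M b) :=
    { toFun := fun τ : unitInterval => M (ℓ τ)
      continuous_toFun := by
        refine hMc.comp_continuous (by simp only [hℓ]; fun_prop) fun τ => hℓO τ τ.2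
      source' := by simp [hℓ]
      target' := by simp [hℓ] }
  have hγ₁ : ∀ τ : unitInterval, γ₁ τ = M (ℓ τ) := fun τ => rfl
  -- the 1-form
  set Ω : ℂ → ℂ →L[ℝ] ℂ := fun w => (wirtingerDz U w * V w) • ContinuousLinearMap.id ℝ ℂ +
    (U w * wirtingerDzbar V w) • (Complex.conjCLE : ℂ →L[ℝ] ℂ) with hΩ
  have hΩapply : ∀ w h : ℂ, Ω w h = greenForm U V w h := fun w h => by
    simp only [hΩ, greenForm, add_apply, smul_apply, ContinuousLinearMap.id_apply,
      ContinuousLinearEquiv.coe_coe, Complex.conjCLE_apply, smul_eq_mul]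
  -- Step 2: the integral over the image path is the curve integral of `Ω` along `γ₁`
  have hstep2 : ∫ᶜ x in γ₁, Ω x =
      ∫ τ in (0 : ℝ)..1, greenForm U V (M (ℓ τ)) (deriv M (ℓ τ) * ((b : ℂ) - a)) := by
    rw [curveIntegral_eq_intervalIntegral_deriv]
    apply intervalIntegral.integral_congr_ae_restrict
    rw [uIoc_of_le zero_le_one, ← restrict_Ioo_eq_restrict_Ioc]
    filter_upwards [ae_restrict_mem (by measurability)] with τ hτ
    have hloc : γ₁.extend =ᶠ[𝓝 τ] fun τ' => M (ℓ τ') := by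
      filter_upwards [Icc_mem_nhds hτ.1 hτ.2] with τ' hτ'
      rw [Path.extend_apply γ₁ hτ']
      rfl
    have hd : HasDerivAt (fun τ' : ℝ => M (ℓ τ')) (deriv M (ℓ τ) * ((b : ℂ) - a)) τ := by
      have h1 : HasDerivAt ℓ ((b : ℂ) - a) τ := by
        simp only [hℓ]; exact AffineMap.hasDerivAt_lineMap
      exact (hMder _ (hℓO τ (Ioo_subset_Icc_self hτ))).comp τ h1
    rw [hloc.deriv_eq, hd.deriv, hloc.eq_of_nhds, hΩapply]
  -- Step 3: the right-hand side is the curve integral along the segment `[g a, g b]`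
  have hMa : M a = ((g • a : ℍ) : ℂ) := by simp [hM]
  have hMb : M b = ((g • b : ℍ) : ℂ) := by simp [hM]
  have hstep3 : greenSegmentIntegral U V (M a) (M b) = ∫ᶜ x in Path.segment (M a) (M b), Ω x :=
    greenSegmentIntegral_eq_curveIntegral U V _ _
  -- Step 4: homotopy invariance inside the convex set `{Im > h + ε}`
  have hMa_h : h < (M a).im := by
    have := harc 0 (left_mem_Icc.mpr zero_le_one)
    simpa [hM] using this
  have hMb_h : h < (M b).im := by
    have := harc 1 (right_mem_Icc.mpr zero_le_one)
    simpa [hM] using this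
  obtain ⟨ε, hε, hεγ, hεa, hεb⟩ : ∃ ε : ℝ, 0 < ε ∧ (∀ τ : unitInterval, h + 2 * ε ≤ (γ₁ τ).im) ∧
      h + 2 * ε ≤ (M a).im ∧ h + 2 * ε ≤ (M b).im := by
    have hcont : Continuous fun τ : unitInterval => (γ₁ τ).im :=
      Complex.continuous_im.comp γ₁.continuous
    obtain ⟨τ₀, -, hτ₀⟩ := isCompact_univ.exists_isMinOn univ_nonempty hcont.continuousOn
    have hpos : h < (γ₁ τ₀).im := by rw [hγ₁]; exact harc' _ τ₀.2
    refine ⟨(min (γ₁ τ₀).im (min (M a).im (M b).im) - h) / 2, by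
      have : h < min (γ₁ τ₀).im (min (M a).im (M b).im) := lt_min hpos (lt_min hMa_h hMb_h)
      linarith, fun τ => ?_, ?_, ?_⟩
    · have hmin : (γ₁ τ₀).im ≤ (γ₁ τ).im := (isMinOn_iff.mp hτ₀) τ (mem_univ τ)
      linarith [min_le_left (γ₁ τ₀).im (min (M a).im (M b).im)]
    · linarith [min_le_right (γ₁ τ₀).im (min (M a).im (M b).im),
        min_le_left (M a).im (M b).im]
    · linarith [min_le_right (γ₁ τ₀).im (min (M a).im (M b).im),
        min_le_right (M a).im (M b).im]
  set T : Set ℂ := {z : ℂ | h + ε < z.im} with hT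
  have hTO : T ⊆ O := fun z hz => by
    simp only [hT, mem_setOf_eq] at hz
    show h < z.im
    linarith
  have hTconv : Convex ℝ T := convex_halfSpace_im_gt (h + ε)
  have hclT : closure T ⊆ O := by
    have : closure T ⊆ {z : ℂ | h + ε ≤ z.im} :=
      closure_minimal (fun z hz => by simp only [mem_setOf_eq] at hz ⊢; exact hz.le)
        (isClosed_le continuous_const Complex.continuous_im)
    intro z hz
    have hz' := this hz
    simp only [mem_setOf_eq] at hz'
    show h < z.im
    linarith
  -- derivative data of `Ω` on `O`
  have hex : ∀ w ∈ O, ∃ D : ℂ →L[ℝ] ℂ →L[ℝ] ℂ, HasFDerivAt Ω D w ∧ ∀ k l : ℂ, D k l = D l k :=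
    fun w hw => hasFDerivAt_greenOneForm_symm hOo hU hV hw (hΔ w hw)
  choose! D hD using hex
  let φ := ContinuousMap.Homotopy.affine (γ₁ : C(unitInterval, ℂ))
    (Path.segment (M a) (M b) : C(unitInterval, ℂ))
  have hφ : ∀ x y : unitInterval, φ (x, y) =
      AffineMap.lineMap (γ₁ y) (AffineMap.lineMap (M a) (M b) (y : ℝ)) (x : ℝ) := fun x y => by
    simp [φ, Path.segment_apply]
  have hhom := φ.curveIntegral_add_curveIntegral_eq_of_hasFDerivWithinAt (t := T) (ω := Ω)
    (dω := D) ?_ ?_ ?_ ?_ ?_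
  · -- conclude from the homotopy identity: the two extra integrals are over constant paths
    have e1 : ∫ᶜ x in φ.evalAt 1, Ω x = 0 := by
      rw [ContinuousMap.Homotopy.evalAt_affine, curveIntegral_segment]
      simp
    have e0 : ∫ᶜ x in φ.evalAt 0, Ω x = 0 := by
      rw [ContinuousMap.Homotopy.evalAt_affine, curveIntegral_segment]
      simp
    rw [e1, e0, add_zero, add_zero] at hhom
    rw [hstep1, ← hstep2, hhom, ← hMa, ← hMb, hstep3]
  · -- the homotopy stays in `T`
    intro x _ y _
    rw [hφ]
    have h1 : h + 2 * ε ≤ (γ₁ y).im := hεγ y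
    have hy0 : 0 ≤ (y : ℝ) := y.2.1
    have hy1 : (y : ℝ) ≤ 1 := y.2.2
    have h2 : h + 2 * ε ≤ (1 - (y : ℝ)) * (M a).im + (y : ℝ) * (M b).im := by
      have p1 := mul_nonneg (sub_nonneg.mpr hy1) (sub_nonneg.mpr hεa)
      have p2 := mul_nonneg hy0 (sub_nonneg.mpr hεb)
      nlinarith
    show h + ε < _
    simp only [AffineMap.lineMap_apply_module, Complex.add_im, Complex.real_smul,
      Complex.mul_im, Complex.ofReal_re, Complex.ofReal_im, zero_mul, add_zero]
    have hx0 : 0 ≤ (x : ℝ) := x.2.1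
    have hx1 : (x : ℝ) ≤ 1 := x.2.2
    have p1 := mul_nonneg (sub_nonneg.mpr hx1) (sub_nonneg.mpr h1)
    have p2 := mul_nonneg hx0 (sub_nonneg.mpr h2)
    nlinarith
  · exact fun w hw => ((hD w (hTO hw)).1).hasFDerivWithinAt
  · exact (continuousOn_greenOneForm hOo hU hV).mono hclT
  · exact fun w hw k _ l _ => (hD w (hTO hw)).2 k l
  · -- `C²`-smoothness of the affine homotopy between the two smooth paths
    have hEq : EqOn (fun xy : ℝ × ℝ => IccExtend zero_le_one (φ.extend xy.1) xy.2)
        (fun xy => AffineMap.lineMap (M (ℓ xy.2)) (AffineMap.lineMap (M a) (M b) xy.2) xy.1)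
        (Icc 0 1) := by
      rw [Icc_prod_eq]
      rintro ⟨x, y⟩ ⟨hx, hy⟩
      lift x to unitInterval using hx
      lift y to unitInterval using hy
      simp [φ, hγ₁, Path.segment_apply]
    refine ContDiffOn.congr ?_ hEq
    have hsq : MapsTo (fun xy : ℝ × ℝ => ℓ xy.2) (Icc (0 : ℝ × ℝ) 1) {z : ℂ | 0 < z.im} := by
      rw [Icc_prod_eq]
      rintro ⟨x, y⟩ ⟨-, hy⟩
      exact hℓO y hy
    have hℓ2 : ContDiff ℝ 2 (fun xy : ℝ × ℝ => ℓ xy.2) := by simp only [hℓ]; fun_prop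
    have hMℓ : ContDiffOn ℝ 2 (fun xy : ℝ × ℝ => M (ℓ xy.2)) (Icc 0 1) :=
      (contDiffOn_smulExtend hg 2).comp hℓ2.contDiffOn hsq
    simp only [AffineMap.lineMap_apply_module]
    apply ContDiffOn.add
    · exact (contDiff_const.sub contDiff_fst).contDiffOn.smul hMℓ
    · exact (contDiff_fst.smul ((contDiff_const.sub contDiff_snd).smul contDiff_const |>.add
        (contDiff_snd.smul contDiff_const))).contDiffOn



/-- Quotients of complex numbers with positive real parts lie in the slit plane. [folklore] -/
theorem div_mem_slitPlane_of_re_pos {A Q : ℂ} (hA : 0 < A.re) (hQ : 0 < Q.re) :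
    A / Q ∈ Complex.slitPlane := by
  rw [Complex.mem_slitPlane_iff_not_le_zero]
  intro hle
  have hQ0 : Q ≠ 0 := fun h => by rw [h] at hQ; simp at hQ
  obtain ⟨hre, him⟩ := Complex.le_def.mp hle
  simp only [Complex.zero_re, Complex.zero_im] at hre him
  set r : ℝ := (A / Q).re with hr
  have hAQ' : A / Q = (r : ℂ) := Complex.ext (by simp [hr]) (by simp [him])
  have hAQ : A = (r : ℂ) * Q := by rw [← hAQ', div_mul_cancel₀ A hQ0]
  have hAre : A.re = r * Q.re := by
    have := congrArg Complex.re hAQ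
    simpa [Complex.re_ofReal_mul] using this
  have : r * Q.re ≤ 0 := mul_nonpos_of_nonpos_of_nonneg hre hQ.le
  linarith

/-- **The cut of the ratio kernel lies below the parameter.** If `0 < Im η < Im a`, then for
every `w ≠ η` with `Im w ≥ Im η` the ratio base `R_η(w)/R_η(a)` is off the cut `(-∞, 0]`:
writing `w = Re η + ξ`, the cut points satisfy `|ξ| < Im η`. Consequently every half-plane
`{Im w > h}` with `h ≥ Im η` is a good convex region for `w ↦ (R_η(w)/R_η(a))^s`.
[cite: BruggemanLewisZagier2015, (1.7) p. 10] -/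
theorem ratioBase_mem_slitPlane_of_im_le {η a w : ℂ} (hη : 0 < η.im) (ha : η.im < a.im)
    (hw : η.im ≤ w.im) (hne : w ≠ η) :
    poissonKernelC η w / poissonKernelC η a ∈ Complex.slitPlane := by
  have hAre : 0 < ((η - a) * (η - conj a)).re := by
    have e : ((η - a) * (η - conj a)).re = (η.re - a.re) ^ 2 + (a.im ^ 2 - η.im ^ 2) := by
      simp only [Complex.mul_re, Complex.sub_re, Complex.sub_im, Complex.conj_re, Complex.conj_im]
      ring
    rw [e]
    have : 0 < a.im ^ 2 - η.im ^ 2 := by nlinarith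
    nlinarith [sq_nonneg (η.re - a.re)]
  have hwim : 0 < w.im := lt_of_lt_of_le hη hw
  have haim : 0 < a.im := lt_trans hη ha
  have hQre : 0 < ((η - w) * (η - conj w)).re := by
    have e : ((η - w) * (η - conj w)).re = (η.re - w.re) ^ 2 + (w.im ^ 2 - η.im ^ 2) := by
      simp only [Complex.mul_re, Complex.sub_re, Complex.sub_im, Complex.conj_re, Complex.conj_im]
      ring
    rw [e]
    have hP : 0 ≤ w.im ^ 2 - η.im ^ 2 := by nlinarith
    by_contra hle
    push Not at hle
    have h3 : (η.re - w.re) ^ 2 = 0 :=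
      le_antisymm (by nlinarith [sq_nonneg (η.re - w.re)]) (sq_nonneg _)
    have h4 : w.im ^ 2 - η.im ^ 2 = 0 := by nlinarith [sq_nonneg (η.re - w.re)]
    have hre' : η.re - w.re = 0 := (pow_eq_zero_iff two_ne_zero).mp h3
    have h5 : (w.im - η.im) * (w.im + η.im) = 0 := by linear_combination h4
    have him' : w.im = η.im := by
      rcases mul_eq_zero.mp h5 with h6 | h6
      · linarith
      · linarith
    exact hne (Complex.ext (by linarith) him')
  have hQ0 : (η - w) * (η - conj w) ≠ 0 := fun h => by rw [h] at hQre; simp at hQre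
  have hA0 : (η - a) * (η - conj a) ≠ 0 := fun h => by rw [h] at hAre; simp at hAre
  have hratio : poissonKernelC η w / poissonKernelC η a =
      ((w.im : ℂ) * ((η - a) * (η - conj a))) / ((a.im : ℂ) * ((η - w) * (η - conj w))) := by
    unfold poissonKernelC
    rw [div_div_div_eq]
    ring
  rw [hratio]
  apply div_mem_slitPlane_of_re_pos
  · rw [Complex.re_ofReal_mul]; exact mul_pos hwim hAre
  · rw [Complex.re_ofReal_mul]; exact mul_pos haim hQre

/-- At such points all hypotheses of the ratio-kernel lemmas hold (`w ∈ ℍ`, `η ≠ w`,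
`η̄ ≠ w`, `R_η(a) ≠ 0`, base off the cut). [folklore] -/
theorem ratioKernel_good_of_im_lt {η a w : ℂ} (hη : 0 < η.im) (ha : η.im < a.im)
    (hw : η.im < w.im) :
    0 < w.im ∧ η ≠ w ∧ conj η ≠ w ∧ poissonKernelC η a ≠ 0 ∧
      poissonKernelC η w / poissonKernelC η a ∈ Complex.slitPlane := by
  have hwim : 0 < w.im := lt_trans hη hw
  refine ⟨hwim, ?_, ?_, ?_, ratioBase_mem_slitPlane_of_im_le hη ha hw.le ?_⟩
  · intro h; rw [h] at hw; exact lt_irrefl _ hw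
  · intro h; have := congrArg Complex.im h; simp at this; linarith
  · refine poissonKernelC_ne_zero (lt_trans hη ha) ?_ ?_
    · intro h; rw [h] at ha; exact lt_irrefl _ ha
    · intro h; have := congrArg Complex.im h; simp at this; linarith
  · intro h; rw [h] at hw; exact lt_irrefl _ hw

end LocalMoebius

/-! ## 20. The image arc stays above the parameter

For the proof of the transformation law of the canonical integral one deforms the `γ⁻¹`-image of
a segment `[z₀, ζ]`, `ζ = γη` close to the real axis, into segments inside a half-plane
`{Im w > h}` with `h > Im η` (where the ratio kernel with parameter `η` is regular, §19). The
elementary estimate below shows that every point of the image arc other than its endpoint `η`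
lies strictly above `Im η` once `Im ζ` is small: with `A = cζ + d`, `v = z₀ - ζ`,
`Im((1-σ)ζ + σ z₀)/|c((1-σ)ζ + σ z₀) + d|² > Im ζ/|A|²` for `0 < σ ≤ 1` as soon as
`Im ζ · (2|c| |A| |v| + c² |v|²) < (Im z₀ - Im ζ) |A|²`. -/

section ArcAbove

/-- **Arc-above estimate** (algebraic form). [folklore] -/
theorem im_div_normSq_moebius_lt {c d : ℝ} {ζ z₀ : ℂ}
    (hcond : ζ.im * (2 * |c| * ‖(c : ℂ) * ζ + d‖ * ‖z₀ - ζ‖ + c ^ 2 * ‖z₀ - ζ‖ ^ 2) <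
      (z₀.im - ζ.im) * ‖(c : ℂ) * ζ + d‖ ^ 2)
    (hζ : 0 < ζ.im) {σ : ℝ} (hσ0 : 0 < σ) (hσ1 : σ ≤ 1)
    (hpole : (c : ℂ) * (ζ + σ * (z₀ - ζ)) + d ≠ 0) :
    ζ.im / ‖(c : ℂ) * ζ + d‖ ^ 2 <
      (ζ + σ * (z₀ - ζ)).im / ‖(c : ℂ) * (ζ + σ * (z₀ - ζ)) + d‖ ^ 2 := by
  set A : ℂ := (c : ℂ) * ζ + d with hA
  set v : ℂ := z₀ - ζ with hv
  have hA0 : 0 < ‖A‖ := by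
    rcases (norm_nonneg A).eq_or_lt with h | h
    · exfalso
      rw [← h] at hcond
      have : 0 ≤ ζ.im * (2 * |c| * 0 * ‖z₀ - ζ‖ + c ^ 2 * ‖z₀ - ζ‖ ^ 2) := by positivity
      nlinarith
    · exact h
  have hden : (c : ℂ) * (ζ + σ * (z₀ - ζ)) + d = A + (σ : ℂ) * (c : ℂ) * v := by
    simp only [hA, hv]; ring
  have him : (ζ + σ * (z₀ - ζ)).im = ζ.im + σ * (z₀.im - ζ.im) := by
    simp
  -- norm bound for the perturbed denominator
  have hB : ‖A + (σ : ℂ) * (c : ℂ) * v‖ ^ 2 ≤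
      ‖A‖ ^ 2 + σ * (2 * |c| * ‖A‖ * ‖v‖ + c ^ 2 * ‖v‖ ^ 2) := by
    have h1 : ‖A + (σ : ℂ) * (c : ℂ) * v‖ ≤ ‖A‖ + σ * |c| * ‖v‖ := by
      calc ‖A + (σ : ℂ) * (c : ℂ) * v‖ ≤ ‖A‖ + ‖(σ : ℂ) * (c : ℂ) * v‖ := norm_add_le _ _
        _ = ‖A‖ + σ * |c| * ‖v‖ := by
          rw [norm_mul, norm_mul, Complex.norm_real, Complex.norm_real, Real.norm_eq_abs,
            Real.norm_eq_abs, abs_of_pos hσ0]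
    have h2 : 0 ≤ ‖A‖ + σ * |c| * ‖v‖ := by positivity
    have h3 : ‖A + (σ : ℂ) * (c : ℂ) * v‖ ^ 2 ≤ (‖A‖ + σ * |c| * ‖v‖) ^ 2 :=
      pow_le_pow_left₀ (norm_nonneg _) h1 2
    have h4 : σ ^ 2 ≤ σ := by nlinarith
    have h5 : 0 ≤ c ^ 2 * ‖v‖ ^ 2 := by positivity
    have h3' : (‖A‖ + σ * |c| * ‖v‖) ^ 2 =
        ‖A‖ ^ 2 + σ * (2 * |c| * ‖A‖ * ‖v‖) + σ ^ 2 * (c ^ 2 * ‖v‖ ^ 2) := by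
      rw [show c ^ 2 = |c| ^ 2 from (sq_abs c).symm]; ring
    have h6 : σ ^ 2 * (c ^ 2 * ‖v‖ ^ 2) ≤ σ * (c ^ 2 * ‖v‖ ^ 2) :=
      mul_le_mul_of_nonneg_right h4 h5
    nlinarith [h3, h3', h6]
  have hpos : 0 < ‖A + (σ : ℂ) * (c : ℂ) * v‖ ^ 2 := by
    rw [← hden]; exact pow_pos (norm_pos_iff.mpr hpole) 2
  rw [hden, him, div_lt_div_iff₀ (pow_pos hA0 2) hpos]
  have hcond' : ζ.im * (2 * |c| * ‖A‖ * ‖v‖ + c ^ 2 * ‖v‖ ^ 2) < (z₀.im - ζ.im) * ‖A‖ ^ 2 := hcond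
  have hσc := mul_lt_mul_of_pos_left hcond' hσ0
  calc ζ.im * ‖A + (σ : ℂ) * (c : ℂ) * v‖ ^ 2
      ≤ ζ.im * (‖A‖ ^ 2 + σ * (2 * |c| * ‖A‖ * ‖v‖ + c ^ 2 * ‖v‖ ^ 2)) :=
        mul_le_mul_of_nonneg_left hB hζ.le
    _ < (ζ.im + σ * (z₀.im - ζ.im)) * ‖A‖ ^ 2 := by nlinarith

end ArcAbove

/-! ## 21. Limits of truncated segment integrals

Two elementary limit statements for segment integrals of the Green's form against a ratio kernel
with an integrable endpoint singularity (`Re s < 1`): the radially truncated integrals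
`∫_{z₀}^{z₀ + c(η - z₀)}` converge to `∫_{z₀}^{η}` as `c → 1⁻`, and, for the kernel with parameter
`η` and a base point `a` above `η`, the integrals `∫_{z₀}^{q}` depend continuously on the endpoint
`q` as `q → η` inside the closed half-plane `{Im q ≥ Im η}` (dominated convergence: on `[z₀, q]`
one has `Im w - Im η ≥ (1-τ)(Im z₀ - Im η)`, so the kernel is `O((1-τ)^{-Re s})` uniformly). -/

section TruncationLimits

variable {s : ℂ}

/-- **Radial truncation**: `∫_{z₀}^{(1-c) z₀ + c η} [U, (R_η/R_η(z₀))^s] → ∫_{z₀}^{η}` as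
`c → 1⁻` (the integrand is integrable on `[0, 1]` for `Re s < 1`).
[cite: BruggemanLewisZagier2015, (1.7) p. 10] -/
theorem tendsto_truncatedCanonical (hs : s.re < 1) {U : ℂ → ℂ}
    (hU : ContDiffOn ℝ 2 U {z : ℂ | 0 < z.im}) {z₀ η : ℂ} (hz₀ : 0 < z₀.im) (hη : 0 < η.im)
    (hne : η ≠ z₀) :
    Tendsto (fun c : ℝ => greenSegmentIntegral U (ratioKernel s z₀ η) z₀
        ((1 - (c : ℂ)) * z₀ + (c : ℂ) * η))
      (𝓝[<] 1) (𝓝 (greenSegmentIntegral U (ratioKernel s z₀ η) z₀ η)) := by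
  set f : ℝ → ℂ := fun τ =>
    greenForm U (ratioKernel s z₀ η) ((1 - (τ : ℂ)) * z₀ + (τ : ℂ) * η) (η - z₀) with hf
  have hint : IntervalIntegrable f volume 0 1 :=
    intervalIntegrable_greenForm_ratioKernel hs hU hz₀ hη hne
  have heq : (fun c : ℝ => greenSegmentIntegral U (ratioKernel s z₀ η) z₀
      ((1 - (c : ℂ)) * z₀ + (c : ℂ) * η)) = fun c => ∫ τ in (0 : ℝ)..c, f τ := by
    funext c
    exact (integral_greenForm_truncate U _ z₀ η c).symm
  rw [heq]
  have hlim : greenSegmentIntegral U (ratioKernel s z₀ η) z₀ η = ∫ τ in (0 : ℝ)..1, f τ := rfl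
  rw [hlim]
  have hcont : ContinuousOn (fun x => ∫ t in (0 : ℝ)..x, f t) (uIcc 0 1) := by
    apply intervalIntegral.continuousOn_primitive_interval
    rw [uIcc_of_le zero_le_one]
    exact (intervalIntegrable_iff_integrableOn_Icc_of_le zero_le_one).mp hint
  have h1 : ContinuousWithinAt (fun x => ∫ t in (0 : ℝ)..x, f t) (Icc 0 1) 1 := by
    have := hcont 1 (by simp)
    rwa [uIcc_of_le zero_le_one] at this
  rw [← nhdsWithin_Ioo_eq_nhdsLT zero_lt_one]
  exact h1.tendsto.mono_left (nhdsWithin_mono _ Ioo_subset_Icc_self)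

/-- `(1 - τ)^r` is integrable on `[0, 1]` for `r > -1`. [folklore] -/
theorem intervalIntegrable_one_sub_rpow {r : ℝ} (hr : -1 < r) :
    IntervalIntegrable (fun τ : ℝ => (1 - τ) ^ r) volume 0 1 := by
  have h := (intervalIntegral.intervalIntegrable_rpow' (a := 0) (b := 1) hr).comp_sub_left 1
  simp only [sub_zero, sub_self] at h
  exact h.symm

/-- `‖x^w‖ ≤ ‖x‖^{Re w} e^{π |Im w|}` for `x ≠ 0`. [folklore] -/
theorem norm_cpow_le_rpow_mul_exp {x : ℂ} (hx : x ≠ 0) (w : ℂ) :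
    ‖x ^ w‖ ≤ ‖x‖ ^ w.re * Real.exp (Real.pi * |w.im|) := by
  rw [Complex.norm_cpow_of_ne_zero hx, div_eq_mul_inv, ← Real.exp_neg]
  have h1 : |arg x * w.im| ≤ Real.pi * |w.im| := by
    rw [abs_mul]
    exact mul_le_mul_of_nonneg_right (Complex.abs_arg_le_pi x) (abs_nonneg _)
  have h2 : -(arg x * w.im) ≤ Real.pi * |w.im| := by linarith [neg_abs_le (arg x * w.im)]
  exact mul_le_mul_of_nonneg_left (Real.exp_le_exp.mpr h2) (by positivity)

/-- `|R_η(w)| ≤ 1/|η - w|` for `w, η ∈ ℍ`, `w ≠ η` (since `|η - w̄| ≥ Im w`).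
[cite: BruggemanLewisZagier2015, (1.7) p. 10] -/
theorem norm_poissonKernelC_le {η w : ℂ} (hη : 0 < η.im) (hw : 0 < w.im) (hne : η ≠ w) :
    ‖poissonKernelC η w‖ ≤ ‖η - w‖⁻¹ := by
  unfold poissonKernelC
  have h1 : w.im ≤ ‖η - conj w‖ := by
    have := Complex.abs_im_le_norm (η - conj w)
    have e : (η - conj w).im = η.im + w.im := by simp
    rw [e, abs_of_pos (by linarith)] at this
    linarith
  have h2 : 0 < ‖η - w‖ := norm_pos_iff.mpr (sub_ne_zero.mpr hne)
  have h3 : 0 < ‖η - conj w‖ := lt_of_lt_of_le hw h1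
  rw [norm_div, norm_mul, Complex.norm_real, Real.norm_eq_abs, abs_of_pos hw]
  calc w.im / (‖η - w‖ * ‖η - conj w‖) ≤ ‖η - conj w‖ / (‖η - w‖ * ‖η - conj w‖) :=
        div_le_div_of_nonneg_right h1 (by positivity)
    _ = ‖η - w‖⁻¹ := by field_simp

/-- **Kernel bound above the parameter**: `‖(R_η(w)/R_η(a))^s‖ ≤ (|η-w| |R_η(a)|)^{-Re s} e^{π|Im s|}`
for `0 ≤ Re s`. [cite: BruggemanLewisZagier2015, (1.7) p. 10] -/
theorem norm_ratioKernel_le (hs : 0 ≤ s.re) {η a w : ℂ} (hη : 0 < η.im) (hw : 0 < w.im)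
    (hne : η ≠ w) (hηw' : η ≠ conj w) (ha : poissonKernelC η a ≠ 0) :
    ‖ratioKernel s a η w‖ ≤
      (‖η - w‖ * ‖poissonKernelC η a‖)⁻¹ ^ s.re * Real.exp (Real.pi * |s.im|) := by
  unfold ratioKernel
  have hx : poissonKernelC η w / poissonKernelC η a ≠ 0 :=
    div_ne_zero (poissonKernelC_ne_zero hw hne hηw') ha
  refine (norm_cpow_le_rpow_mul_exp hx s).trans ?_
  have hle : ‖poissonKernelC η w / poissonKernelC η a‖ ≤ (‖η - w‖ * ‖poissonKernelC η a‖)⁻¹ := by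
    rw [norm_div, mul_inv, div_eq_mul_inv]
    exact mul_le_mul_of_nonneg_right (norm_poissonKernelC_le hη hw hne) (by positivity)
  exact mul_le_mul_of_nonneg_right (Real.rpow_le_rpow (norm_nonneg _) hle hs) (by positivity)

attribute [local irreducible] ratioKernel poissonKernelC in
/-- Joint continuity of `(w, h) ↦ [U, (R_η/R_η(a))^s](w)(h)` at good points `w`.
[folklore] -/
theorem continuousAt_greenForm_ratioKernel {U : ℂ → ℂ}
    (hU : ContDiffOn ℝ 2 U {z : ℂ | 0 < z.im}) (s : ℂ) {η a w : ℂ} (hw : 0 < w.im) (hηw : η ≠ w)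
    (hηw' : conj η ≠ w) (hpz : poissonKernelC η a ≠ 0)
    (hslit : poissonKernelC η w / poissonKernelC η a ∈ Complex.slitPlane) (h : ℂ) :
    ContinuousAt (fun p : ℂ × ℂ => greenForm U (ratioKernel s a η) p.1 p.2) (w, h) := by
  have hO : IsOpen {z : ℂ | 0 < z.im} := isOpen_upperHalfPlaneSet
  have hV : ContDiffAt ℝ 2 (ratioKernel s a η) w := contDiffAt_ratioKernel s hηw hηw' hpz hslit 2
  have h1 : ContinuousAt (fun w' => wirtingerDz U w') w :=
    (continuousOn_wirtingerDz hO hU).continuousAt (hO.mem_nhds hw)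
  have h2 : ContinuousAt (ratioKernel s a η) w := hV.continuousAt
  have h3 : ContinuousAt U w := hU.continuousOn.continuousAt (hO.mem_nhds hw)
  have h4 : ContinuousAt (fun w' => wirtingerDzbar (ratioKernel s a η) w') w := by
    have hD : ContinuousAt (fderiv ℝ (ratioKernel s a η)) w := hV.continuousAt_fderiv (by norm_num)
    unfold wirtingerDzbar
    exact ((hD.clm_apply continuousAt_const).add
      (continuousAt_const.mul (hD.clm_apply continuousAt_const))).div_const _
  have e : (fun p : ℂ × ℂ => greenForm U (ratioKernel s a η) p.1 p.2) = fun p : ℂ × ℂ =>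
      wirtingerDz U p.1 * ratioKernel s a η p.1 * p.2 +
        U p.1 * wirtingerDzbar (ratioKernel s a η) p.1 * conj p.2 := by
    funext p; rfl
  rw [e]
  have hf : ContinuousAt (fun p : ℂ × ℂ => p.1) (w, h) := continuousAt_fst
  have hsn : ContinuousAt (fun p : ℂ × ℂ => p.2) (w, h) := continuousAt_snd
  have g1 : ContinuousAt (fun p : ℂ × ℂ => wirtingerDz U p.1) (w, h) :=
    ContinuousAt.comp (g := fun w' => wirtingerDz U w') h1 hf
  have g2 : ContinuousAt (fun p : ℂ × ℂ => ratioKernel s a η p.1) (w, h) :=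
    ContinuousAt.comp (g := ratioKernel s a η) h2 hf
  have g3 : ContinuousAt (fun p : ℂ × ℂ => U p.1) (w, h) := ContinuousAt.comp (g := U) h3 hf
  have g4 : ContinuousAt (fun p : ℂ × ℂ => wirtingerDzbar (ratioKernel s a η) p.1) (w, h) :=
    ContinuousAt.comp (g := fun w' => wirtingerDzbar (ratioKernel s a η) w') h4 hf
  have g5 : ContinuousAt (fun p : ℂ × ℂ => conj p.2) (w, h) :=
    Complex.continuous_conj.continuousAt.comp hsn
  exact ((g1.mul g2).mul hsn).add ((g3.mul g4).mul g5)

attribute [local irreducible] ratioKernel poissonKernelC in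
/-- **Cone limit.** For the ratio kernel with parameter `η` and base point `a` above `η`
(`Im η < Im a`), and a start point `z₀` above `η`, the segment integrals `∫_{z₀}^{q} [U, (R_η/R_η(a))^s]`
depend continuously on the endpoint `q` as `q → η` within `{Im q ≥ Im η}` (`0 ≤ Re s < 1`).
[cite: BruggemanLewisZagier2015, Proposition 5.1 pp. 30–31] -/
theorem continuousWithinAt_canonicalCone (hs : s.re < 1) (hs' : 0 ≤ s.re) {U : ℂ → ℂ}
    (hU : ContDiffOn ℝ 2 U {z : ℂ | 0 < z.im}) {η a z₀ : ℂ} (hη : 0 < η.im) (ha : η.im < a.im)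
    (hz₀ : η.im < z₀.im) :
    ContinuousWithinAt (fun q : ℂ => greenSegmentIntegral U (ratioKernel s a η) z₀ q)
      {q : ℂ | η.im ≤ q.im} η := by
  have hO : IsOpen {z : ℂ | 0 < z.im} := isOpen_upperHalfPlaneSet
  -- the points of the segments and their height
  have hwim : ∀ (τ : ℝ) (q : ℂ), ((1 - (τ : ℂ)) * z₀ + (τ : ℂ) * q).im = (1 - τ) * z₀.im + τ * q.im := by
    intro τ q; simp
  have him_lb : ∀ q : ℂ, η.im ≤ q.im → ∀ τ ∈ Icc (0 : ℝ) 1,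
      η.im + (1 - τ) * (z₀.im - η.im) ≤ ((1 - (τ : ℂ)) * z₀ + (τ : ℂ) * q).im := by
    intro q hq τ hτ
    rw [hwim]
    nlinarith [hτ.1, hτ.2]
  have hgoodw : ∀ q : ℂ, η.im ≤ q.im → ∀ τ ∈ Ico (0 : ℝ) 1,
      η.im < ((1 - (τ : ℂ)) * z₀ + (τ : ℂ) * q).im := by
    intro q hq τ hτ
    have h1 := him_lb q hq τ ⟨hτ.1, hτ.2.le⟩
    have h2 : 0 < (1 - τ) * (z₀.im - η.im) := mul_pos (by linarith [hτ.2]) (by linarith)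
    linarith
  have hpa : poissonKernelC η a ≠ 0 := (ratioKernel_good_of_im_lt hη ha ha).2.2.2.1
  -- (1) the integrand is continuous in `(q, τ)` at good configurations
  have hcontAt : ∀ q : ℂ, η.im ≤ q.im → ∀ τ ∈ Ico (0 : ℝ) 1,
      ContinuousAt (fun p : ℂ × ℝ => greenForm U (ratioKernel s a η)
        ((1 - (p.2 : ℂ)) * z₀ + (p.2 : ℂ) * p.1) (p.1 - z₀)) (q, τ) := by
    intro q hq τ hτ
    obtain ⟨hw, hηw, hηw', hpz, hslit⟩ := ratioKernel_good_of_im_lt hη ha (hgoodw q hq τ hτ)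
    have hG := continuousAt_greenForm_ratioKernel hU s hw hηw hηw' hpz hslit (q - z₀)
    have hinner : ContinuousAt (fun p : ℂ × ℝ => (((1 - (p.2 : ℂ)) * z₀ + (p.2 : ℂ) * p.1), p.1 - z₀))
        (q, τ) := by fun_prop
    have hcomp := ContinuousAt.comp (g := fun p : ℂ × ℂ => greenForm U (ratioKernel s a η) p.1 p.2)
      (f := fun p : ℂ × ℝ => (((1 - (p.2 : ℂ)) * z₀ + (p.2 : ℂ) * p.1), p.1 - z₀)) (x := (q, τ))
      hG hinner
    simpa only [Function.comp_def] using hcomp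
  -- (2) bounds on a compact region containing all segments `[z₀, q]`, `q ∈ B(η, 1)`, `Im q ≥ Im η`
  obtain ⟨Kc, hKc⟩ : ∃ Kc : Set ℂ, Kc = {w : ℂ | η.im ≤ w.im} ∩ Metric.closedBall z₀ (‖η - z₀‖ + 1) :=
    ⟨_, rfl⟩
  have hKc_cpt : IsCompact Kc := by
    rw [hKc]
    exact (isCompact_closedBall _ _).inter_left (isClosed_le continuous_const Complex.continuous_im)
  have hKcH : Kc ⊆ {z : ℂ | 0 < z.im} := fun w hw => by
    rw [hKc] at hw; exact lt_of_lt_of_le hη hw.1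
  obtain ⟨B₁, hB₁⟩ := hKc_cpt.exists_bound_of_continuousOn (hU.continuousOn.mono hKcH)
  obtain ⟨B₂, hB₂⟩ := hKc_cpt.exists_bound_of_continuousOn ((continuousOn_wirtingerDz hO hU).mono hKcH)
  obtain ⟨B, hB0, hBU, hBDU⟩ : ∃ B : ℝ, 0 ≤ B ∧ (∀ w ∈ Kc, ‖U w‖ ≤ B) ∧
      (∀ w ∈ Kc, ‖wirtingerDz U w‖ ≤ B) :=
    ⟨max (max B₁ B₂) 0, le_max_right _ _,
      fun w hw => (hB₁ w hw).trans ((le_max_left _ _).trans (le_max_left _ _)),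
      fun w hw => (hB₂ w hw).trans ((le_max_right _ _).trans (le_max_left _ _))⟩
  have hmemKc : ∀ q : ℂ, η.im ≤ q.im → q ∈ Metric.ball η 1 → ∀ τ ∈ Icc (0 : ℝ) 1,
      (1 - (τ : ℂ)) * z₀ + (τ : ℂ) * q ∈ Kc := by
    intro q hq hqb τ hτ
    rw [hKc]
    refine ⟨?_, ?_⟩
    · show η.im ≤ ((1 - (τ : ℂ)) * z₀ + (τ : ℂ) * q).im
      have := him_lb q hq τ hτ
      have : 0 ≤ (1 - τ) * (z₀.im - η.im) := mul_nonneg (by linarith [hτ.2]) (by linarith)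
      linarith
    · rw [Metric.mem_closedBall, dist_eq_norm]
      have e : (1 - (τ : ℂ)) * z₀ + (τ : ℂ) * q - z₀ = (τ : ℂ) * (q - z₀) := by ring
      rw [e, norm_mul, Complex.norm_real, Real.norm_eq_abs, abs_of_nonneg hτ.1]
      have hq1 : ‖q - z₀‖ ≤ ‖η - z₀‖ + 1 := by
        have h1 := norm_sub_le (q - η) (z₀ - η)
        have e2 : q - η - (z₀ - η) = q - z₀ := by ring
        rw [e2] at h1
        rw [Metric.mem_ball, dist_eq_norm] at hqb
        have : ‖z₀ - η‖ = ‖η - z₀‖ := norm_sub_rev _ _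
        linarith
      calc τ * ‖q - z₀‖ ≤ 1 * ‖q - z₀‖ := mul_le_mul_of_nonneg_right hτ.2 (norm_nonneg _)
        _ ≤ ‖η - z₀‖ + 1 := by rw [one_mul]; exact hq1
  -- constants
  have hκ0 : 0 < z₀.im - η.im := by linarith
  have hPa0 : 0 < ‖poissonKernelC η a‖ := norm_pos_iff.mpr hpa
  obtain ⟨C₁, hC₁⟩ : ∃ C₁ : ℝ, C₁ = ((z₀.im - η.im) * ‖poissonKernelC η a‖)⁻¹ ^ s.re *
      Real.exp (Real.pi * |s.im|) := ⟨_, rfl⟩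
  have hC₁0 : 0 ≤ C₁ := by rw [hC₁]; positivity
  obtain ⟨L, hL⟩ : ∃ L : ℝ, L = ‖η - z₀‖ + 1 := ⟨_, rfl⟩
  have hL0 : 0 < L := by rw [hL]; positivity
  obtain ⟨C₂, hC₂⟩ : ∃ C₂ : ℝ, C₂ = ‖s‖ * (2 * L) / (2 * η.im ^ 2) := ⟨_, rfl⟩
  have hC₂0 : 0 ≤ C₂ := by rw [hC₂]; positivity
  obtain ⟨bound, hbound⟩ : ∃ bound : ℝ → ℝ,
      bound = fun τ => B * (1 + C₂) * L * C₁ * (1 - τ) ^ (-s.re) := ⟨_, rfl⟩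
  -- (3) the pointwise bound
  have hptw : ∀ q : ℂ, η.im ≤ q.im → q ∈ Metric.ball η 1 → ∀ τ ∈ Ico (0 : ℝ) 1,
      ‖greenForm U (ratioKernel s a η) ((1 - (τ : ℂ)) * z₀ + (τ : ℂ) * q) (q - z₀)‖ ≤ bound τ := by
    intro q hq hqb τ hτ
    obtain ⟨w, hw_def⟩ : ∃ w : ℂ, w = (1 - (τ : ℂ)) * z₀ + (τ : ℂ) * q := ⟨_, rfl⟩
    rw [← hw_def]
    have hgw : η.im < w.im := by rw [hw_def]; exact hgoodw q hq τ hτ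
    obtain ⟨hw, hηw, hηw', hpz, hslit⟩ := ratioKernel_good_of_im_lt hη ha hgw
    have hwK : w ∈ Kc := by rw [hw_def]; exact hmemKc q hq hqb τ ⟨hτ.1, hτ.2.le⟩
    have hUw : ‖U w‖ ≤ B := hBU w hwK
    have hDUw : ‖wirtingerDz U w‖ ≤ B := hBDU w hwK
    have hηw'' : η ≠ conj w := by
      intro h; have := congrArg Complex.im h; simp at this; linarith
    -- distance from `η`
    have hdist : (1 - τ) * (z₀.im - η.im) ≤ ‖η - w‖ := by
      have h1 := him_lb q hq τ ⟨hτ.1, hτ.2.le⟩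
      rw [← hw_def] at h1
      have h2 : |(η - w).im| ≤ ‖η - w‖ := Complex.abs_im_le_norm _
      have e : (η - w).im = η.im - w.im := by simp
      rw [e] at h2
      have h3 : w.im - η.im ≤ ‖η - w‖ := by
        have := neg_abs_le (η.im - w.im); linarith
      linarith
    have h1τ : 0 < 1 - τ := by linarith [hτ.2]
    -- the kernel
    have hKw : ‖ratioKernel s a η w‖ ≤ C₁ * (1 - τ) ^ (-s.re) := by
      refine (norm_ratioKernel_le hs' hη hw hηw hηw'' hpz).trans ?_
      have hprod : (1 - τ) * (z₀.im - η.im) * ‖poissonKernelC η a‖ ≤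
          ‖η - w‖ * ‖poissonKernelC η a‖ := mul_le_mul_of_nonneg_right hdist hPa0.le
      have hpos : 0 < (1 - τ) * (z₀.im - η.im) * ‖poissonKernelC η a‖ := by positivity
      have hinv : (‖η - w‖ * ‖poissonKernelC η a‖)⁻¹ ≤
          ((1 - τ) * (z₀.im - η.im) * ‖poissonKernelC η a‖)⁻¹ := inv_anti₀ hpos hprod
      calc (‖η - w‖ * ‖poissonKernelC η a‖)⁻¹ ^ s.re * Real.exp (Real.pi * |s.im|)
          ≤ ((1 - τ) * (z₀.im - η.im) * ‖poissonKernelC η a‖)⁻¹ ^ s.re *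
              Real.exp (Real.pi * |s.im|) := by
            apply mul_le_mul_of_nonneg_right _ (by positivity)
            exact Real.rpow_le_rpow (by positivity) hinv hs'
        _ = C₁ * (1 - τ) ^ (-s.re) := by
            rw [hC₁, show (1 - τ) * (z₀.im - η.im) * ‖poissonKernelC η a‖ =
              (1 - τ) * ((z₀.im - η.im) * ‖poissonKernelC η a‖) from by ring, mul_inv,
              Real.mul_rpow (by positivity) (by positivity), Real.inv_rpow h1τ.le,
              ← Real.rpow_neg h1τ.le]
            ring
    -- the `∂̄`-factor
    have hfac : ‖s * Complex.I * (η - w) / (2 * ((w.im : ℝ) : ℂ) * (η - conj w))‖ ≤ C₂ := by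
      have hnum : ‖η - w‖ ≤ 2 * L := by
        have h1 : ‖w - z₀‖ ≤ ‖η - z₀‖ + 1 := by
          have h2 := hwK; rw [hKc] at h2
          have h3 := h2.2
          rwa [Metric.mem_closedBall, dist_eq_norm] at h3
        calc ‖η - w‖ = ‖(η - z₀) - (w - z₀)‖ := by ring_nf
          _ ≤ ‖η - z₀‖ + ‖w - z₀‖ := norm_sub_le _ _
          _ ≤ 2 * L := by rw [hL]; linarith [norm_nonneg (η - z₀)]
      have hden1 : w.im ≤ ‖η - conj w‖ := by
        have h1 := Complex.abs_im_le_norm (η - conj w)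
        have e : (η - conj w).im = η.im + w.im := by simp
        rw [e, abs_of_pos (by linarith)] at h1
        linarith
      have hwim' : η.im ≤ w.im := hgw.le
      rw [norm_div, norm_mul, norm_mul, Complex.norm_I, mul_one, norm_mul, norm_mul,
        Complex.norm_real, Real.norm_eq_abs, abs_of_pos hw, Complex.norm_two]
      have hden_pos : 0 < 2 * w.im * ‖η - conj w‖ :=
        mul_pos (mul_pos two_pos hw) (lt_of_lt_of_le hw hden1)
      rw [div_le_iff₀ hden_pos, hC₂]
      have e3 : ‖s‖ * (2 * L) / (2 * η.im ^ 2) * (2 * w.im * ‖η - conj w‖) =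
          ‖s‖ * (2 * L) * ((w.im * ‖η - conj w‖) / η.im ^ 2) := by
        field_simp
      rw [e3]
      have hr : 1 ≤ (w.im * ‖η - conj w‖) / η.im ^ 2 := by
        rw [le_div_iff₀ (by positivity), one_mul]
        calc η.im ^ 2 = η.im * η.im := sq _
          _ ≤ w.im * ‖η - conj w‖ := mul_le_mul hwim' (hwim'.trans hden1) hη.le hw.le
      calc ‖s‖ * ‖η - w‖ ≤ ‖s‖ * (2 * L) := mul_le_mul_of_nonneg_left hnum (norm_nonneg _)
        _ = ‖s‖ * (2 * L) * 1 := (mul_one _).symm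
        _ ≤ ‖s‖ * (2 * L) * ((w.im * ‖η - conj w‖) / η.im ^ 2) :=
            mul_le_mul_of_nonneg_left hr (by positivity)
    -- assemble
    have hqz : ‖q - z₀‖ ≤ L := by
      have h1 := hmemKc q hq hqb 1 ⟨zero_le_one, le_rfl⟩
      rw [hKc] at h1
      have h2 := h1.2
      rw [Metric.mem_closedBall, dist_eq_norm] at h2
      rw [hL]
      simpa using h2
    rw [greenForm, wirtingerDzbar_ratioKernel s hw hηw hηw'' hpz hslit]
    have hKn := norm_nonneg (ratioKernel s a η w)
    calc ‖wirtingerDz U w * ratioKernel s a η w * (q - z₀) +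
          U w * (ratioKernel s a η w * (s * Complex.I * (η - w) /
            (2 * ((w.im : ℝ) : ℂ) * (η - conj w)))) * conj (q - z₀)‖
        ≤ ‖wirtingerDz U w‖ * ‖ratioKernel s a η w‖ * ‖q - z₀‖ +
          ‖U w‖ * (‖ratioKernel s a η w‖ * ‖s * Complex.I * (η - w) /
            (2 * ((w.im : ℝ) : ℂ) * (η - conj w))‖) * ‖q - z₀‖ := by
          refine (norm_add_le _ _).trans (le_of_eq ?_)
          simp only [norm_mul, Complex.norm_conj]
      _ ≤ B * (C₁ * (1 - τ) ^ (-s.re)) * L + B * ((C₁ * (1 - τ) ^ (-s.re)) * C₂) * L := by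
          gcongr
      _ = bound τ := by rw [hbound]; ring
  -- (4) dominated convergence
  have hSball : {q : ℂ | η.im ≤ q.im} ∩ Metric.ball η 1 ∈ 𝓝[{q : ℂ | η.im ≤ q.im}] η :=
    inter_mem_nhdsWithin _ (Metric.ball_mem_nhds η one_pos)
  have h1ae : ∀ᵐ t : ℝ, t ≠ (1 : ℝ) := by rw [ae_iff]; simp
  unfold greenSegmentIntegral
  apply intervalIntegral.continuousWithinAt_of_dominated_interval (bound := bound)
  · filter_upwards [hSball] with q hq
    have hcont : ContinuousOn (fun τ : ℝ => greenForm U (ratioKernel s a η)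
        ((1 - (τ : ℂ)) * z₀ + (τ : ℂ) * q) (q - z₀)) (Ioo 0 1) := by
      apply continuousOn_of_forall_continuousAt
      intro τ hτ
      have hA := hcontAt q hq.1 τ ⟨hτ.1.le, hτ.2⟩
      have hinner : ContinuousAt (fun τ' : ℝ => (q, τ')) τ := by fun_prop
      have hcomp := ContinuousAt.comp (g := fun p : ℂ × ℝ => greenForm U (ratioKernel s a η)
        ((1 - (p.2 : ℂ)) * z₀ + (p.2 : ℂ) * p.1) (p.1 - z₀)) (f := fun τ' : ℝ => (q, τ')) (x := τ)
        hA hinner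
      simpa only [Function.comp_def] using hcomp
    rw [uIoc_of_le zero_le_one, ← Measure.restrict_congr_set Ioo_ae_eq_Ioc]
    exact hcont.aestronglyMeasurable measurableSet_Ioo
  · filter_upwards [hSball] with q hq
    filter_upwards [h1ae] with τ hτ1 hτ
    rw [uIoc_of_le zero_le_one] at hτ
    exact hptw q hq.1 hq.2 τ ⟨hτ.1.le, lt_of_le_of_ne hτ.2 hτ1⟩
  · rw [hbound]
    exact (intervalIntegrable_one_sub_rpow (by linarith)).const_mul _
  · filter_upwards [h1ae] with τ hτ1 hτ
    rw [uIoc_of_le zero_le_one] at hτ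
    have hτ' : τ ∈ Ico (0 : ℝ) 1 := ⟨hτ.1.le, lt_of_le_of_ne hτ.2 hτ1⟩
    have hA := hcontAt η (le_refl η.im) τ hτ'
    have hinner : ContinuousAt (fun q : ℂ => (q, τ)) η := by fun_prop
    have hcomp := ContinuousAt.comp (g := fun p : ℂ × ℝ => greenForm U (ratioKernel s a η)
      ((1 - (p.2 : ℂ)) * z₀ + (p.2 : ℂ) * p.1) (p.1 - z₀)) (f := fun q' : ℂ => (q', τ)) (x := η)
      hA hinner
    have hcomp' : ContinuousAt (fun q : ℂ => greenForm U (ratioKernel s a η)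
        ((1 - (τ : ℂ)) * z₀ + (τ : ℂ) * q) (q - z₀)) η := by
      simpa only [Function.comp_def] using hcomp
    exact hcomp'.continuousWithinAt

end TruncationLimits

/-! ## 22. The transformation law of the canonical integral

For `g ∈ Γ` (determinant one), `z₀ ∈ ℍ`, `ζ ∈ ℍ` close to a real point, `η = g ζ`, `a₁ = g z₀`
and `μ = R_η(z₀)/R_η(a₁)`, the canonical integral satisfies
`∫_{z₀}^{ζ} [u, (R_ζ/R_ζ(z₀))^s] = μ^s ( ∫_{a₁}^{z₀} [u, (R_η/R_η(z₀))^s] + ∫_{z₀}^{η} [u, (R_η/R_η(z₀))^s] )`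
(companion paper §4.2: `γ`-equivariance of the canonical hybrid model up to the factor
`(R_η(z₀)/R_η(a₁))^s`). Proof: radial truncation, the local Möbius change of variables (§19) —
the `g`-image arc of `[z₀, ζ_c]` stays above `Im η` (§20) where the kernel with parameter `η` is
regular — the closedness of the form on the half-plane above `η`, the cone limit (§21), and the
branch split `(R_η(w)/R_η(a₁))^s = μ^s (R_η(w)/R_η(z₀))^s` (both factors have positive real part). -/

section TransformationLaw

variable {Γ : Subgroup (GL (Fin 2) ℝ)} {s : ℂ} {u : ℍ → ℂ}

/-- The action of `g` with `det g > 0` as a fraction. [folklore] -/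
theorem coe_smul_eq_div {g : GL (Fin 2) ℝ} (hg : 0 < g.det.val) (z : ℍ) :
    ((g • z : ℍ) : ℂ) =
      ((g 0 0 : ℝ) * (z : ℂ) + (g 0 1 : ℝ)) / ((g 1 0 : ℝ) * (z : ℂ) + (g 1 1 : ℝ)) := by
  rw [UpperHalfPlane.coe_smul_of_det_pos hg]
  rfl

/-- `Im (g z) = Im z/|cz + d|²` for `det g = 1`. [folklore] -/
theorem im_smul_eq_of_det_one {g : GL (Fin 2) ℝ} (hg : g.det.val = 1) (z : ℍ) :
    (g • z).im = z.im / ‖(g 1 0 : ℂ) * (z : ℂ) + (g 1 1 : ℝ)‖ ^ 2 := by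
  rw [UpperHalfPlane.im_smul_eq_div_normSq, hg, abs_one, one_mul, Complex.normSq_eq_norm_sq]
  rfl

/-- The denominator of the action does not vanish on `ℍ`. [folklore] -/
theorem smul_denom_ne_zero (g : GL (Fin 2) ℝ) (z : ℍ) :
    (g 1 0 : ℂ) * (z : ℂ) + (g 1 1 : ℝ) ≠ 0 := by
  have := UpperHalfPlane.denom_ne_zero g z
  simpa [UpperHalfPlane.denom] using this

/-- **Exact Möbius invariance of the ratio kernel**, `GL`-form:
`(R_{gζ}(g w)/R_{gζ}(g z₀))^s = (R_ζ(w)/R_ζ(z₀))^s` for `det g = 1`.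
[cite: BruggemanLewisZagier2015, (2.25) p. 16] -/
theorem ratioKernel_smul {g : GL (Fin 2) ℝ} (hg : g.det.val = 1) (s : ℂ) (z₀ ζ w : ℍ) :
    ratioKernel s ((g • z₀ : ℍ) : ℂ) ((g • ζ : ℍ) : ℂ) ((g • w : ℍ) : ℂ) =
      ratioKernel s (z₀ : ℂ) (ζ : ℂ) (w : ℂ) := by
  have hg' : 0 < g.det.val := by rw [hg]; exact one_pos
  rw [coe_smul_eq_div hg', coe_smul_eq_div hg', coe_smul_eq_div hg']
  have hdet : g 0 0 * g 1 1 - g 0 1 * g 1 0 = 1 := by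
    have h : g.val.det = 1 := hg
    rw [Matrix.det_fin_two] at h
    exact h
  exact ratioKernel_moebius hdet (smul_denom_ne_zero g ζ) (smul_denom_ne_zero g w)
    (smul_denom_ne_zero g z₀) s

/-- `(xy)^s = x^s y^s` for `Re x, Re y > 0` (the arguments add up inside `(-π, π)`). [folklore] -/
private theorem mul_cpow_of_re_pos_aux {x y : ℂ} (hx : 0 < x.re) (hy : 0 < y.re) (s : ℂ) :
    (x * y) ^ s = x ^ s * y ^ s := by
  have hx0 : x ≠ 0 := fun h => by rw [h] at hx; simp at hx
  have hy0 : y ≠ 0 := fun h => by rw [h] at hy; simp at hy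
  have harg : arg x + arg y ∈ Set.Ioc (-Real.pi) Real.pi := by
    have h1 := Complex.abs_arg_lt_pi_div_two_iff.mpr (Or.inl hx)
    have h2 := Complex.abs_arg_lt_pi_div_two_iff.mpr (Or.inl hy)
    rw [abs_lt] at h1 h2
    constructor <;> linarith [Real.pi_pos]
  rw [Complex.cpow_def_of_ne_zero (mul_ne_zero hx0 hy0), Complex.cpow_def_of_ne_zero hx0,
    Complex.cpow_def_of_ne_zero hy0, Complex.log_mul hx0 hy0 harg, add_mul, Complex.exp_add]

/-- **Branch split of the ratio kernel** (change of base point):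
`(R_η(w)/R_η(a))^s = (R_η(b)/R_η(a))^s (R_η(w)/R_η(b))^s` when `R_η(w)/R_η(b)` and
`R_η(b)/R_η(a)` have positive real parts. [cite: BruggemanLewisZagier2015, (1.7) p. 10] -/
theorem ratioKernel_base_change (s : ℂ) {η a b w : ℂ} (ha : poissonKernelC η a ≠ 0)
    (hb : poissonKernelC η b ≠ 0) (hx : 0 < (poissonKernelC η w / poissonKernelC η b).re)
    (hμ : 0 < (poissonKernelC η b / poissonKernelC η a).re) :
    ratioKernel s a η w = (poissonKernelC η b / poissonKernelC η a) ^ s * ratioKernel s b η w := by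
  unfold ratioKernel
  have e : poissonKernelC η w / poissonKernelC η a =
      (poissonKernelC η w / poissonKernelC η b) * (poissonKernelC η b / poissonKernelC η a) := by
    field_simp
  rw [e, mul_cpow_of_re_pos_aux hx hμ, mul_comm]

/-- `w ↦ R_η(w)` is continuous at `w ≠ η, η̄`. [folklore] -/
theorem continuousAt_poissonKernelC {η w : ℂ} (hηw : η ≠ w) (hηw' : η ≠ conj w) :
    ContinuousAt (poissonKernelC η) w :=
  (differentiableAt_poissonKernelC hηw hηw').continuousAt

/-- **Branch split inside the Green's form**: at a point `w ∈ ℍ` (`w ≠ η, η̄`) where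
`Re(R_η(w)/R_η(b)) > 0`, `[U, (R_η/R_η(a))^s](w) = (R_η(b)/R_η(a))^s [U, (R_η/R_η(b))^s](w)`
(the kernels agree, up to the constant, on a neighbourhood of `w`).
[cite: BruggemanLewisZagier2015, (1.7) p. 10] -/
theorem greenForm_ratioKernel_base_change (s : ℂ) (U : ℂ → ℂ) {η a b w : ℂ}
    (hηw : η ≠ w) (hηw' : η ≠ conj w) (ha : poissonKernelC η a ≠ 0)
    (hb : poissonKernelC η b ≠ 0) (hx : 0 < (poissonKernelC η w / poissonKernelC η b).re)
    (hμ : 0 < (poissonKernelC η b / poissonKernelC η a).re) (h : ℂ) :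
    greenForm U (ratioKernel s a η) w h =
      (poissonKernelC η b / poissonKernelC η a) ^ s * greenForm U (ratioKernel s b η) w h := by
  have hcont : ContinuousAt (fun w' => (poissonKernelC η w' / poissonKernelC η b).re) w :=
    Complex.continuous_re.continuousAt.comp ((continuousAt_poissonKernelC hηw hηw').div_const _)
  have hev : ∀ᶠ w' in 𝓝 w, 0 < (poissonKernelC η w' / poissonKernelC η b).re :=
    hcont.eventually (isOpen_Ioi.mem_nhds hx)
  have hK : ratioKernel s a η =ᶠ[𝓝 w]
      fun w' => (poissonKernelC η b / poissonKernelC η a) ^ s * ratioKernel s b η w' := by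
    filter_upwards [hev] with w' hw'
    exact ratioKernel_base_change s ha hb hw' hμ
  rw [greenForm_congr (Filter.EventuallyEq.refl _ U) hK, greenForm_const_mul]

/-- The ratio base from the segment start has positive real part along the open segment.
[folklore] -/
theorem re_ratioBase_segment_pos {z₀ η : ℂ} (hz₀ : 0 < z₀.im) (hη : 0 < η.im) (hne : η ≠ z₀)
    {τ : ℝ} (hτ : τ ∈ Ico (0 : ℝ) 1) :
    0 < (poissonKernelC η ((1 - (τ : ℂ)) * z₀ + (τ : ℂ) * η) / poissonKernelC η z₀).re := by
  obtain ⟨W, hre, -, heq⟩ := ratioBase_segment hz₀ hη hne hτ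
  rw [heq, Complex.re_ofReal_mul]
  have hτ1 : 0 < (1 - τ)⁻¹ := inv_pos.mpr (by linarith [hτ.2])
  exact mul_pos hτ1 hre

/-- Points `(1-c) z₀ + c ζ` of a segment in `ℍ` are in `ℍ`. [folklore] -/
theorem im_pos_of_segment {z₀ ζ : ℂ} (hz₀ : 0 < z₀.im) (hζ : 0 < ζ.im) {c : ℝ} (hc : c ∈ Icc (0 : ℝ) 1) :
    0 < ((1 - (c : ℂ)) * z₀ + (c : ℂ) * ζ).im :=
  lt_of_lt_of_le (lt_min hz₀ hζ) (segment_im_ge hc)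

attribute [local irreducible] ratioKernel poissonKernelC in
/-- **Transformation law of the canonical integral.** For `g ∈ Γ` of determinant one,
`z₀, ζ ∈ ℍ`, `η = g ζ`, `a₁ = g z₀`, and under the smallness conditions (valid when `ζ` is close to
the real axis, §23): `Im η < Im a₁, Im z₀`, the arc-above condition of §20, and positivity of the
real parts of `μ = R_η(z₀)/R_η(a₁)` and of `R_η(w)/R_η(z₀)` along `[a₁, z₀]`, one has
`∫_{z₀}^{ζ} [u, (R_ζ/R_ζ(z₀))^s] = μ^s (∫_{a₁}^{z₀} [u, (R_η/R_η(z₀))^s] + ∫_{z₀}^{η} [u, (R_η/R_η(z₀))^s])`.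
[cite: BruggemanLewisZagier2015, Proposition 5.1 pp. 30–31] -/
theorem canonicalIntegral_transform (hu : IsInvariantEigenfunction Γ s u) (hs : s.re < 1)
    (hs' : 0 < s.re) (hs1 : s ≠ 1) {g : GL (Fin 2) ℝ} (hg : g ∈ Γ) (hdet : g.det.val = 1)
    (z₀ ζ : ℍ) (hζ : (ζ : ℂ) ≠ z₀) {η a₁ : ℂ} (hη : ((g • ζ : ℍ) : ℂ) = η)
    (ha₁ : ((g • z₀ : ℍ) : ℂ) = a₁) (h1 : η.im < a₁.im) (h2 : η.im < (z₀ : ℂ).im)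
    (hcond : (ζ : ℂ).im * (2 * |g 1 0| * ‖(g 1 0 : ℂ) * ζ + (g 1 1 : ℝ)‖ * ‖(z₀ : ℂ) - ζ‖ +
        (g 1 0) ^ 2 * ‖(z₀ : ℂ) - ζ‖ ^ 2) <
      ((z₀ : ℂ).im - (ζ : ℂ).im) * ‖(g 1 0 : ℂ) * ζ + (g 1 1 : ℝ)‖ ^ 2)
    (hμ : 0 < (poissonKernelC η z₀ / poissonKernelC η a₁).re)
    (hseg : ∀ w ∈ segment ℝ a₁ (z₀ : ℂ), 0 < (poissonKernelC η w / poissonKernelC η z₀).re) :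
    greenSegmentIntegral (u ∘ ofComplex) (ratioKernel s z₀ ζ) z₀ ζ =
      (poissonKernelC η z₀ / poissonKernelC η a₁) ^ s *
        (greenSegmentIntegral (u ∘ ofComplex) (ratioKernel s z₀ η) a₁ z₀ +
          greenSegmentIntegral (u ∘ ofComplex) (ratioKernel s z₀ η) z₀ η) := by
  have hs0 : s ≠ 0 := fun h => by rw [h] at hs'; simp at hs'
  have hg' : 0 < g.det.val := by rw [hdet]; exact one_pos
  set U : ℂ → ℂ := u ∘ ofComplex with hUdef
  have hU : ContDiffOn ℝ 2 U {z : ℂ | 0 < z.im} := hu.isC2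
  have hO : IsOpen {z : ℂ | 0 < z.im} := isOpen_upperHalfPlaneSet
  have hη0 : 0 < η.im := by rw [← hη, UpperHalfPlane.coe_im]; exact (g • ζ).im_pos
  have ha₁0 : 0 < a₁.im := lt_trans hη0 h1
  have hz₀0 : 0 < (z₀ : ℂ).im := z₀.coe_im_pos
  have hζ0 : 0 < (ζ : ℂ).im := ζ.coe_im_pos
  have hpa₁ : poissonKernelC η a₁ ≠ 0 := (ratioKernel_good_of_im_lt hη0 h1 h1).2.2.2.1
  have hpz₀ : poissonKernelC η z₀ ≠ 0 := (ratioKernel_good_of_im_lt hη0 h2 h2).2.2.2.1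
  -- the Möbius map as a map of `ℂ`
  set M : ℂ → ℂ := fun w : ℂ => ((g • ofComplex w : ℍ) : ℂ) with hM
  have hMpt : ∀ {w : ℂ} (hw : 0 < w.im), M w = ((g • (⟨w, hw⟩ : ℍ) : ℍ) : ℂ) := fun hw => by
    simp only [hM, UpperHalfPlane.ofComplex_apply_of_im_pos hw]
  have hMim : ∀ {w : ℂ} (hw : 0 < w.im),
      (M w).im = w.im / ‖(g 1 0 : ℂ) * w + (g 1 1 : ℝ)‖ ^ 2 := fun hw => by
    rw [hMpt hw, UpperHalfPlane.coe_im, im_smul_eq_of_det_one hdet]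
    rfl
  have hηim : η.im = (ζ : ℂ).im / ‖(g 1 0 : ℂ) * ζ + (g 1 1 : ℝ)‖ ^ 2 := by
    rw [← hη, UpperHalfPlane.coe_im, im_smul_eq_of_det_one hdet, UpperHalfPlane.coe_im]
  have hMζ : M ζ = η := by rw [hMpt hζ0]; simpa using hη
  -- (I) the kernels correspond, (II) `u` is invariant
  have hKM : ∀ w : ℂ, 0 < w.im → ratioKernel s a₁ η (M w) = ratioKernel s z₀ ζ w := by
    intro w hw
    have e := ratioKernel_smul hdet s z₀ ζ ⟨w, hw⟩
    rw [hη, ha₁] at e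
    rw [hMpt hw]
    exact e
  have hUM : ∀ w : ℂ, 0 < w.im → U (M w) = U w := by
    intro w hw
    rw [hMpt hw]
    simp only [hUdef, Function.comp_apply, UpperHalfPlane.ofComplex_apply,
      UpperHalfPlane.ofComplex_apply_of_im_pos hw]
    exact hu.invariant g hg ⟨w, hw⟩
  -- arc points `ζ + σ (z₀ - ζ)`, `0 < σ ≤ 1`, are mapped strictly above `Im η`
  have harc_σ : ∀ σ : ℝ, 0 < σ → σ ≤ 1 →
      η.im < (M ((ζ : ℂ) + (σ : ℂ) * ((z₀ : ℂ) - ζ))).im := by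
    intro σ hσ0 hσ1
    have hp_im : 0 < ((ζ : ℂ) + (σ : ℂ) * ((z₀ : ℂ) - ζ)).im := by
      have : ((ζ : ℂ) + (σ : ℂ) * ((z₀ : ℂ) - ζ)).im = (ζ : ℂ).im + σ * ((z₀ : ℂ).im - (ζ : ℂ).im) := by
        simp
      rw [this]; nlinarith
    rw [hMim hp_im, hηim]
    exact im_div_normSq_moebius_lt hcond hζ0 hσ0 hσ1 (smul_denom_ne_zero g ⟨_, hp_im⟩)
  -- (III) the truncated identity
  have hstep : ∀ c ∈ Ioo (0 : ℝ) 1,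
      greenSegmentIntegral U (ratioKernel s z₀ ζ) z₀ ((1 - (c : ℂ)) * z₀ + (c : ℂ) * ζ) =
        greenSegmentIntegral U (ratioKernel s a₁ η) a₁ z₀ +
          greenSegmentIntegral U (ratioKernel s a₁ η) z₀ (M ((1 - (c : ℂ)) * z₀ + (c : ℂ) * ζ)) := by
    intro c hc
    have hζc_im : 0 < ((1 - (c : ℂ)) * z₀ + (c : ℂ) * ζ).im :=
      im_pos_of_segment hz₀0 hζ0 ⟨hc.1.le, hc.2.le⟩
    set ζc : ℍ := ⟨(1 - (c : ℂ)) * z₀ + (c : ℂ) * ζ, hζc_im⟩ with hζc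
    have hζc_coe : (ζc : ℂ) = (1 - (c : ℂ)) * z₀ + (c : ℂ) * ζ := rfl
    -- points of `[z₀, ζc]` are `ζ + σ (z₀ - ζ)` with `σ = 1 - τ c`
    have hline : ∀ τ : ℝ, (AffineMap.lineMap (z₀ : ℂ) (ζc : ℂ) τ : ℂ) =
        (ζ : ℂ) + ((1 - τ * c : ℝ) : ℂ) * ((z₀ : ℂ) - ζ) := by
      intro τ
      rw [AffineMap.lineMap_apply_module, hζc_coe]
      simp only [Complex.real_smul]
      push_cast
      ring
    have harc : ∀ τ ∈ Icc (0 : ℝ) 1,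
        η.im < (((g • ofComplex (AffineMap.lineMap (z₀ : ℂ) (ζc : ℂ) τ)) : ℍ) : ℂ).im := by
      intro τ hτ
      have hσ0 : 0 < 1 - τ * c := by nlinarith [hτ.2, hc.2, hc.1, hτ.1]
      have hσ1 : 1 - τ * c ≤ 1 := by nlinarith [hτ.1, hc.1]
      have := harc_σ (1 - τ * c) hσ0 hσ1
      rw [hline τ]
      exact this
    -- the minimum of `Im` along the image arc and the level `h`
    have harc_cont : ContinuousOn (fun τ : ℝ =>
        (((g • ofComplex (AffineMap.lineMap (z₀ : ℂ) (ζc : ℂ) τ)) : ℍ) : ℂ).im) (Icc 0 1) := by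
      have hMc : ContinuousOn M {z : ℂ | 0 < z.im} := continuousOn_smulExtend hg'
      have hℓ : Continuous (fun τ : ℝ => (AffineMap.lineMap (z₀ : ℂ) (ζc : ℂ) τ : ℂ)) :=
        AffineMap.lineMap_continuous
      have hmaps : MapsTo (fun τ : ℝ => (AffineMap.lineMap (z₀ : ℂ) (ζc : ℂ) τ : ℂ)) (Icc 0 1)
          {z : ℂ | 0 < z.im} := by
        intro τ hτ
        show 0 < (AffineMap.lineMap (z₀ : ℂ) (ζc : ℂ) τ : ℂ).im
        rw [hline τ]
        have hσ0 : 0 ≤ 1 - τ * c := by nlinarith [hτ.2, hc.2, hc.1, hτ.1]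
        have e : ((ζ : ℂ) + ((1 - τ * c : ℝ) : ℂ) * ((z₀ : ℂ) - ζ)).im =
            (ζ : ℂ).im + (1 - τ * c) * ((z₀ : ℂ).im - (ζ : ℂ).im) := by simp
        rw [e]
        rcases le_or_gt ((z₀ : ℂ).im) ((ζ : ℂ).im) with hle | hgt
        · have hσ1 : 1 - τ * c ≤ 1 := by nlinarith [hτ.1, hc.1]
          nlinarith
        · nlinarith
      exact Complex.continuous_im.comp_continuousOn (hMc.comp hℓ.continuousOn hmaps)
    obtain ⟨τ₀, hτ₀, hmin⟩ := isCompact_Icc.exists_isMinOn (nonempty_Icc.mpr zero_le_one) harc_cont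
    set m : ℝ := (((g • ofComplex (AffineMap.lineMap (z₀ : ℂ) (ζc : ℂ) τ₀)) : ℍ) : ℂ).im with hm
    have hmη : η.im < m := harc τ₀ hτ₀
    set h : ℝ := (η.im + min m (z₀ : ℂ).im) / 2 with hh_def
    have hh0 : 0 ≤ h := by
      have : 0 < min m (z₀ : ℂ).im := lt_min (lt_trans hη0 hmη) hz₀0
      simp only [hh_def]; linarith
    have hηh : η.im < h := by
      have : η.im < min m (z₀ : ℂ).im := lt_min hmη h2
      simp only [hh_def]; linarith
    have hhm : h < m := by
      have : min m (z₀ : ℂ).im ≤ m := min_le_left _ _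
      simp only [hh_def]; linarith
    have hhz₀ : h < (z₀ : ℂ).im := by
      have : min m (z₀ : ℂ).im ≤ (z₀ : ℂ).im := min_le_right _ _
      simp only [hh_def]; linarith
    -- goodness above the level `h`
    have hgood : ∀ w : ℂ, h < w.im → 0 < w.im ∧ η ≠ w ∧ conj η ≠ w ∧
        poissonKernelC η a₁ ≠ 0 ∧ poissonKernelC η w / poissonKernelC η a₁ ∈ Complex.slitPlane :=
      fun w hw => ratioKernel_good_of_im_lt hη0 h1 (lt_trans hηh hw)
    have hV : ContDiffOn ℝ 2 (ratioKernel s a₁ η) {z : ℂ | h < z.im} := by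
      intro w hw
      obtain ⟨-, hηw, hηw', hpz, hslit⟩ := hgood w hw
      exact (contDiffAt_ratioKernel s hηw hηw' hpz hslit 2).contDiffWithinAt
    have hΔ : ∀ w : ℂ, h < w.im →
        U w * (Δ (ratioKernel s a₁ η)) w = ratioKernel s a₁ η w * (Δ U) w := by
      intro w hw
      obtain ⟨hw0, hηw, hηw', hpz, hslit⟩ := hgood w hw
      exact mul_laplacian_comm_ratioKernel hu hs0 hs1 hw0 hηw hηw' hpz hslit
    have hUh : ContDiffOn ℝ 2 U {z : ℂ | h < z.im} := hU.mono fun w hw => lt_of_le_of_lt hh0 hw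
    -- local Möbius change of variables
    have hmob := greenSegmentIntegral_comp_smul_of_level (U := U) (V := ratioKernel s a₁ η) hg' hh0
      hUh hV hΔ z₀ ζc (fun τ hτ => lt_of_lt_of_le hhm (hmin hτ))
    -- the left side is the truncated canonical integral
    have hlhs : greenSegmentIntegral (U ∘ M) (ratioKernel s a₁ η ∘ M) z₀ ζc =
        greenSegmentIntegral U (ratioKernel s z₀ ζ) z₀ ζc :=
      greenSegmentIntegral_congr_upperHalfPlane (fun w hw => hUM w hw) (fun w hw => hKM w hw) z₀ ζc
    -- the right side: `g z₀ = a₁`, `g ζc = M ζc`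
    have hMa : ((g • z₀ : ℍ) : ℂ) = a₁ := ha₁
    have hMζc : ((g • ζc : ℍ) : ℂ) = M ζc := by rw [hMpt hζc_im]
    rw [hMa, hMζc] at hmob
    rw [← hlhs, hmob]
    -- triangle on the half-plane `{Im > h}`
    have hOo : IsOpen {z : ℂ | h < z.im} := isOpen_lt continuous_const Complex.continuous_im
    have hOc : Convex ℝ {z : ℂ | h < z.im} := convex_halfSpace_im_gt h
    have hOgood : ∀ w ∈ {z : ℂ | h < z.im}, 0 < w.im ∧ η ≠ w ∧ conj η ≠ w ∧
        poissonKernelC η w / poissonKernelC η a₁ ∈ Complex.slitPlane := by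
      intro w hw
      obtain ⟨hw0, hηw, hηw', -, hslit⟩ := hgood w hw
      exact ⟨hw0, hηw, hηw', hslit⟩
    have ha₁O : a₁ ∈ {z : ℂ | h < z.im} := by
      show h < a₁.im
      have e0 : (AffineMap.lineMap (z₀ : ℂ) (ζc : ℂ) (0 : ℝ) : ℂ) = z₀ := by
        rw [hline 0]; push_cast; ring
      have h0 : m ≤ (((g • ofComplex (AffineMap.lineMap (z₀ : ℂ) (ζc : ℂ) (0 : ℝ))) : ℍ) : ℂ).im :=
        hmin (show (0 : ℝ) ∈ Icc (0 : ℝ) 1 from ⟨le_rfl, zero_le_one⟩)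
      rw [e0, UpperHalfPlane.ofComplex_apply, ha₁] at h0
      exact lt_of_lt_of_le hhm h0
    have hz₀O : (z₀ : ℂ) ∈ {z : ℂ | h < z.im} := hhz₀
    have hqO : M ζc ∈ {z : ℂ | h < z.im} := by
      show h < (M ζc).im
      have e1 : (AffineMap.lineMap (z₀ : ℂ) (ζc : ℂ) (1 : ℝ) : ℂ) = ζc := by
        rw [hline 1, hζc_coe]; push_cast; ring
      have h0 : m ≤ (((g • ofComplex (AffineMap.lineMap (z₀ : ℂ) (ζc : ℂ) (1 : ℝ))) : ℍ) : ℂ).im :=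
        hmin (show (1 : ℝ) ∈ Icc (0 : ℝ) 1 from ⟨zero_le_one, le_rfl⟩)
      rw [e1, UpperHalfPlane.ofComplex_apply, hMζc] at h0
      exact lt_of_lt_of_le hhm h0
    exact (greenSegmentIntegral_ratioKernel_triangle hu hs0 hs1 hOo hOc hOgood hpa₁ ha₁O hz₀O hqO).symm
  -- (IV) limits `c → 1⁻`
  have hlim_lhs : Tendsto (fun c : ℝ => greenSegmentIntegral U (ratioKernel s z₀ ζ) z₀
      ((1 - (c : ℂ)) * z₀ + (c : ℂ) * ζ)) (𝓝[<] 1)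
      (𝓝 (greenSegmentIntegral U (ratioKernel s z₀ ζ) z₀ ζ)) :=
    tendsto_truncatedCanonical hs hU hz₀0 hζ0 hζ
  -- the endpoints `q_c = M ζ_c` tend to `η` inside `{Im ≥ Im η}`
  have hq_tend : Tendsto (fun c : ℝ => M ((1 - (c : ℂ)) * z₀ + (c : ℂ) * ζ)) (𝓝[<] 1)
      (𝓝[{q : ℂ | η.im ≤ q.im}] η) := by
    have hMc : ContinuousOn M {z : ℂ | 0 < z.im} := continuousOn_smulExtend hg'
    have hpath : Continuous (fun c : ℝ => (1 - (c : ℂ)) * (z₀ : ℂ) + (c : ℂ) * ζ) := by fun_prop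
    have h1 : Tendsto (fun c : ℝ => (1 - (c : ℂ)) * (z₀ : ℂ) + (c : ℂ) * ζ) (𝓝[<] 1) (𝓝 (ζ : ℂ)) := by
      have := hpath.tendsto 1
      simp only [Complex.ofReal_one, sub_self, zero_mul, zero_add, one_mul] at this
      exact this.mono_left nhdsWithin_le_nhds
    have h2 : Tendsto M (𝓝[{z : ℂ | 0 < z.im}] (ζ : ℂ)) (𝓝 η) := by
      rw [← hMζ]; exact hMc (ζ : ℂ) hζ0
    have h1' : Tendsto (fun c : ℝ => (1 - (c : ℂ)) * (z₀ : ℂ) + (c : ℂ) * ζ) (𝓝[<] 1)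
        (𝓝[{z : ℂ | 0 < z.im}] (ζ : ℂ)) := by
      refine tendsto_nhdsWithin_iff.mpr ⟨h1, ?_⟩
      filter_upwards [Ioo_mem_nhdsLT zero_lt_one] with c hc
      exact im_pos_of_segment hz₀0 hζ0 ⟨hc.1.le, hc.2.le⟩
    refine tendsto_nhdsWithin_iff.mpr ⟨h2.comp h1', ?_⟩
    filter_upwards [Ioo_mem_nhdsLT zero_lt_one] with c hc
    show η.im ≤ (M ((1 - (c : ℂ)) * z₀ + (c : ℂ) * ζ)).im
    have e : (1 - (c : ℂ)) * (z₀ : ℂ) + (c : ℂ) * ζ = (ζ : ℂ) + ((1 - c : ℝ) : ℂ) * ((z₀ : ℂ) - ζ) := by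
      push_cast; ring
    rw [e]
    exact (harc_σ (1 - c) (by linarith [hc.2]) (by linarith [hc.1])).le
  have hcone := continuousWithinAt_canonicalCone (z₀ := (z₀ : ℂ)) hs hs'.le hU hη0 h1 h2
  have hlim_rhs : Tendsto (fun c : ℝ => greenSegmentIntegral U (ratioKernel s a₁ η) a₁ z₀ +
      greenSegmentIntegral U (ratioKernel s a₁ η) z₀ (M ((1 - (c : ℂ)) * z₀ + (c : ℂ) * ζ)))
      (𝓝[<] 1) (𝓝 (greenSegmentIntegral U (ratioKernel s a₁ η) a₁ z₀ +
        greenSegmentIntegral U (ratioKernel s a₁ η) z₀ η)) :=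
    tendsto_const_nhds.add (hcone.tendsto.comp hq_tend)
  have heq_fun : (fun c : ℝ => greenSegmentIntegral U (ratioKernel s z₀ ζ) z₀
      ((1 - (c : ℂ)) * z₀ + (c : ℂ) * ζ)) =ᶠ[𝓝[<] 1]
      fun c : ℝ => greenSegmentIntegral U (ratioKernel s a₁ η) a₁ z₀ +
        greenSegmentIntegral U (ratioKernel s a₁ η) z₀ (M ((1 - (c : ℂ)) * z₀ + (c : ℂ) * ζ)) := by
    filter_upwards [Ioo_mem_nhdsLT zero_lt_one] with c hc
    exact hstep c hc
  have hmain : greenSegmentIntegral U (ratioKernel s z₀ ζ) z₀ ζ =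
      greenSegmentIntegral U (ratioKernel s a₁ η) a₁ z₀ +
        greenSegmentIntegral U (ratioKernel s a₁ η) z₀ η :=
    tendsto_nhds_unique (hlim_lhs.congr' heq_fun) hlim_rhs
  -- (V) branch split on `[a₁, z₀]` and on `[z₀, η)`
  have hI₁ : greenSegmentIntegral U (ratioKernel s a₁ η) a₁ z₀ =
      (poissonKernelC η z₀ / poissonKernelC η a₁) ^ s *
        greenSegmentIntegral U (ratioKernel s z₀ η) a₁ z₀ := by
    unfold greenSegmentIntegral
    rw [← intervalIntegral.integral_const_mul]
    refine intervalIntegral.integral_congr fun τ hτ => ?_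
    rw [uIcc_of_le zero_le_one] at hτ
    have hwseg : (1 - (τ : ℂ)) * a₁ + (τ : ℂ) * (z₀ : ℂ) ∈ segment ℝ a₁ (z₀ : ℂ) := by
      rw [segment_eq_image_lineMap]
      refine ⟨τ, hτ, ?_⟩
      rw [AffineMap.lineMap_apply_module]; simp only [Complex.real_smul]; push_cast; ring
    have hwim : η.im < ((1 - (τ : ℂ)) * a₁ + (τ : ℂ) * (z₀ : ℂ)).im :=
      lt_of_lt_of_le (lt_min h1 h2) (segment_im_ge hτ)
    obtain ⟨-, hηw, hηw', -, -⟩ := ratioKernel_good_of_im_lt hη0 h1 hwim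
    have hηw'' : η ≠ conj ((1 - (τ : ℂ)) * a₁ + (τ : ℂ) * (z₀ : ℂ)) :=
      fun hh => hηw' ((congrArg conj hh).trans (Complex.conj_conj _))
    exact greenForm_ratioKernel_base_change s U hηw hηw'' hpa₁ hpz₀ (hseg _ hwseg) hμ _
  have hI₂ : greenSegmentIntegral U (ratioKernel s a₁ η) z₀ η =
      (poissonKernelC η z₀ / poissonKernelC η a₁) ^ s *
        greenSegmentIntegral U (ratioKernel s z₀ η) z₀ η := by
    unfold greenSegmentIntegral
    rw [← intervalIntegral.integral_const_mul]
    have h1ae : ∀ᵐ t : ℝ, t ≠ (1 : ℝ) := by rw [ae_iff]; simp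
    refine intervalIntegral.integral_congr_ae ?_
    filter_upwards [h1ae] with τ hτ1 hτ
    rw [uIoc_of_le zero_le_one] at hτ
    have hτ' : τ ∈ Ico (0 : ℝ) 1 := ⟨hτ.1.le, lt_of_le_of_ne hτ.2 hτ1⟩
    have hx := re_ratioBase_segment_pos hz₀0 hη0 (by
      intro hh; rw [hh] at h2; exact lt_irrefl _ h2) hτ'
    obtain ⟨hslit, hηw, hηw', -⟩ := ratioBase_segment_mem_slitPlane hz₀0 hη0 (by
      intro hh; rw [hh] at h2; exact lt_irrefl _ h2) hτ'
    have hηw'' : η ≠ conj ((1 - (τ : ℂ)) * (z₀ : ℂ) + (τ : ℂ) * η) :=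
      fun hh => hηw' ((congrArg conj hh).trans (Complex.conj_conj _))
    exact greenForm_ratioKernel_base_change s U hηw hηw'' hpa₁ hpz₀ hx hμ _
  rw [hmain, hI₁, hI₂]
  ring

end TransformationLaw

end Literature.NumberTheory.Automorphic
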